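/-
Copyright (c) 2026 the pub-hodgecm-mathlib formalisation cell (harness21).  Prover seat hodgecm-mathlib-K2E3-p11 (g7), Track B «K2-LIT» ∕ h413
(`stmt-HodgeConjecture-24833`), leaf (nsc-S-A′) «principal-block standard span», case brick C2 «cube» (architect K2E3-p25 (g2) `MEMO-SA-architecture.v2` §3,
dealer K2E3-plan (g4)), file C2c: CLASS C₂ (the Steinberg class) — `tr W = tr I − tr D − tr D′ + tr π₁`, ORIENTATION-FREE.  2026-09-04.
-/
import Summits.HodgeConjecture.HodgeConjecture.Theorems.K2E3GL3CubeClassFour   -- ★ C2b′ (K2E3-p11): the W-trick; brings C2b ∕ C2b-wt ∕ C2b-gen ∕ C2a ∕ REG ∕ H0 ∕ …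
import HarnessLib

/-!
# K2_E3 road (h413), leaf (nsc-S-A′), case brick C2 «cube», file C2c — class C₂ (Steinberg): `tr W = tr I(C₁) − tr D − tr D′ + tr π₁`

Cell `pub/hodgecm-mathlib` (D-0151), Track B, seat K2E3-p11 (g7); architecture K2E3-p25 (g2) `MEMO-SA-architecture.v2` §3, C2 PLAN v1 (K2 bus 2026-09-04 11:36Z, (P1) C₂).
`--supports stmt-HodgeConjecture-24833 --as helper`; THEOREMS ONLY (no definition ∕ instance ∕ notation ∕ named fact ∕ `sorry`); COUNT-NEUTRAL.

CURRENCY (★ C2b-wt header): cube letters `a, aν, aν²`, the six orderings `C₁ … C₄′`, `I C`, `wt C`, `mult`, `π₁`, `D := D(aν½, aν²) ↪ I C₁` (★ C2a), `D′ := D(aν ν½, a)`.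
HYPOTHESIS-FIRST (discharged BY NAME in the final brick): `hD`, `hD′` (GEO-QB G3c tables, K2E5-p17 (g7)) with `[FiniteDimensional ℂ (r_B D)]`, `[… (r_B D′)]`;
`hS₁₂` (★ H0 ED. 2 `finrank_weightSpace_swap₁₂` at `(aν, a, aν²)`, rigidity of C₄); `hJ₁`, `hJ₄′` (★ E4a for `I C₁`, `I C₄′`).

THE MATHEMATICS — ORIENTATION-FREE: no «the generic constituent is a quotient» input ([Zelevinsky1980, §1, Thm. 6.1, Cor. 7.5, §9]; [BernsteinZelevinsky1977, §2.3, Cor. 2.13,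
Thm. 2.9]; [Rodier1982, §5]).  Let `V₂ := I C₁ ⁄ D` (for an embedding `Φ_D : D ↪ I C₁`, ★ C2a); §1 `E(V₂) = E(I C₁) − E(D) = {C₂, C₄, C₄′}` with multiplicity one (★ REG
table of `I C₁` via ★ C2b-wt, `hD`, ★ ADD).  §2 TWO PIECES: for smooth `Z₁, Z₂` (f.d. `r_B`, `hJ`) whose weights ADD UP to `{C₄ ↦ 1, C₄′ ↦ 1}` the rigidity `hS₁₂` puts the whole
class into ONE of them — irreducible (★ C2b-gen (I2)) with trace `tr D′ − tr π₁` (★ C2b′ W-trick) — the other having no weight, hence `0` (★ C2b-gen) with trace `0`: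
**`tr Z₁ + tr Z₂ = tr D′ − tr π₁`**.  §3 For an irreducible smooth `W` with `mult W (wt C₂) ≠ 0`: ★ EMB gives `Ψ : V₂ → I C₂` non-zero (as `wt C₂ ∈ E(V₂)`) and `W ↪ I C₂`;
`mult (I C₂) (wt C₂) = 1` (★ REG) and the SOCLE ARGUMENT (★ C2b-gen) put the image of `W` inside `range Ψ`; with `P := Ψ⁻¹(W) ≤ V₂` and `T := ker (Ψ|_P)` the first
isomorphism theorem (★ C2b-gen) gives `P ⁄ T ≅ W`; `E(W) = {C₂}` (`C₁, C₃` absent from `E(V₂)`, `C₄` excluded by ★ C2b′ `weights_of_weight_C₄`), so the weights of `T` and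
`V₂ ⁄ P` add up to `{C₄, C₄′}` and §2 applies; additivity of the character on the admissible `I C₁ ↠ V₂ ⊇ P ⊇ T` then yields **`tr W = tr I(C₁) − tr D − tr D′ + tr π₁`** (§3).
HONEST LABEL: HC_CM is proved only modulo the 7 printed citations (2 remaining named inputs: hLiu418 = stmt-HodgeConjecture-24832, h413 = stmt-HodgeConjecture-24833)
until rung 0 closes; count-neutral helper.

## Mathlib ∕ tree search
Tree ★: C2b′ `smoothTrace_of_weight_C₄`∕`weights_of_weight_C₄` · C2b `wt_ne_of_apply_ne`∕`table_D` · C2b-gen (plumbing, (I2), zero representation, socle) · C2b-wt (tables of `I C`) · C2a `exists_injective_intertwiningMap_D` ·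
EMB `exists_intertwiningMap_parabolicIndGL_ne_zero`∕`exists_injective_…`∕`finrank_weightSpace_ne_zero_of_intertwiningMap_ne_zero` · ADD `finrank_weightSpace_eq_add_add`∕`_eq_add_subrepresentation`∕`_eq_of_equiv` · EXH ·
`isAdmissible_parabolicIndGL_holds`, `isAdmissible_trivial_twist`, `IsAdmissible.quotientRep∕toRepresentation`, `smoothTrace_eq_add_of_subrepresentation`, `smoothTrace_eq_of_equiv`.  Dedup: `rg "CubeClassTwo|smoothTrace_of_weight_C₂"` — none.

## References
* [Zelevinsky1980] A. V. Zelevinsky, *Induced representations of reductive p-adic groups II*, Ann. Sci. ÉNS 13 (1980), §1, Thm. 6.1, Cor. 7.5, §9.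
* [BernsteinZelevinsky1977] I. N. Bernstein, A. V. Zelevinsky, *Induced representations of reductive p-adic groups I*, Ann. Sci. ÉNS 10 (1977), §2.3, Cor. 2.13, Thm. 2.9.
* [Rodier1982] F. Rodier, *Représentations de GL(n, k) où k est un corps p-adique*, Sém. Bourbaki 587 (1982), §5.
-/

set_option autoImplicit false
-- the mandated namespace repeats the single-problem summit's segment (`HodgeConjecture.HodgeConjecture`)
set_option linter.dupNamespace false

noncomputable section

open Module Function MeasureTheory
open scoped MatrixGroups
open Literature.NumberTheory.Automorphic ValuativeRel Representation
open Literature.NumberTheory.GaloisRepresentations Literature.NumberTheory.GaloisRepresentations.IsNonarchimedeanLocalField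
open Literature.RepresentationTheory.FiniteGroups Literature.RepresentationTheory.Semisimple
open Summit.HodgeConjecture.HodgeConjecture.Cruxes.H413.K2E3GL3JacquetMultiplicityAdditive
open Summit.HodgeConjecture.HodgeConjecture.Cruxes.H413.K2E3GL3EmbeddingOfWeight
open Summit.HodgeConjecture.HodgeConjecture.Cruxes.H413.K2E3GL3PrincipalSeriesExhaustion
open Summit.HodgeConjecture.HodgeConjecture.Cruxes.H413.K2E3GL3ExponentClassTools
open Summit.HodgeConjecture.HodgeConjecture.Cruxes.H413.K2E3GL3CubeStandardModules
open Summit.HodgeConjecture.HodgeConjecture.Cruxes.H413.K2E3GL3CubeWeights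
open Summit.HodgeConjecture.HodgeConjecture.Cruxes.H413.K2E3GL3CubeConstituents
open Summit.HodgeConjecture.HodgeConjecture.Cruxes.H413.K2E3GL3CubeClassFour

namespace Summit.HodgeConjecture.HodgeConjecture.Cruxes.H413.K2E3GL3CubeClassTwo

variable {F : Type} [Field F] [ValuativeRel F] [TopologicalSpace F] [IsNonarchimedeanLocalField F]
  (a : Fˣ →* ℂˣ) (ha : IsOpen ((a.ker : Subgroup Fˣ) : Set Fˣ))

open scoped Classical

/-! ## §1 `V₂ = I C₁ ⁄ D`: admissibility and weights -/

include ha in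
/-- `I C₁` is admissible (★ `isAdmissible_parabolicIndGL` on the admissible character `tch C₁`). [cite: BernsteinZelevinsky1977, Prop. 2.3] -/
theorem isAdmissible_I_cube : (Representation.parabolicIndGL F (id : Fin 3 → Fin 3) ((Representation.trivial ℂ (Π t : Fin 3, GL {i : Fin 3 // (id : Fin 3 → Fin 3) i = t} F) ℂ).twist (∏ i : Fin 3, ((![a, a * ((unramifiedTwist F 1 : QuasiChar F).toMonoidHom), a * ((unramifiedTwist F 1 : QuasiChar F).toMonoidHom) * ((unramifiedTwist F 1 : QuasiChar F).toMonoidHom)] : Fin 3 → (Fˣ →* ℂˣ)) i).comp (Matrix.GeneralLinearGroup.det.comp (Pi.evalMonoidHom (fun t : Fin 3 => GL {i : Fin 3 // (id : Fin 3 → Fin 3) i = t} F) i))))).IsAdmissible :=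
  Representation.isAdmissible_parabolicIndGL_holds F (id : Fin 3 → Fin 3) _
    (isAdmissible_trivial_twist (isOpen_ker_tch_three _ _ _ ha (isOpen_ker_letters a ha).1 (isOpen_ker_letters a ha).2))

include ha in
/-- **`E(I C₁ ⁄ D) = {{C₂, C₄, C₄′}}` with multiplicity one**: for an injective `Φ_D : D → I C₁`, the quotient `I C₁ ⁄ range Φ_D` has `mult = 1` at `wt C₂`, `wt C₄`, `wt C₄′` and `0` at
every other `ζ` (★ REG table of `I C₁`: `1` on the six orderings, `0` off them; `hD`; ★ ADD along `range Φ_D ≅ D`). [cite: Zelevinsky1980, §1, §9] [cite: BernsteinZelevinsky1977, Thm. 5.2, §2.3] -/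
theorem weights_quotient_I_D_pos [FiniteDimensional ℂ (Representation.restrictUnipotentGL F (id : Fin 3 → Fin 3) (Representation.parabolicIndGL F (![false, false, true] : Fin 3 → Bool) ((Representation.trivial ℂ (Π t : Bool, GL {i : Fin 3 // (![false, false, true] : Fin 3 → Bool) i = t} F) ℂ).twist ((a * ((unramifiedTwist F (1 / 2) : QuasiChar F).toMonoidHom)).comp ((Matrix.GeneralLinearGroup.det : GL {i : Fin 3 // (![false, false, true] : Fin 3 → Bool) i = false} F →* Fˣ).comp (Pi.evalMonoidHom (fun t : Bool => GL {i : Fin 3 // (![false, false, true] : Fin 3 → Bool) i = t} F) false)) * (a * ((unramifiedTwist F 1 : QuasiChar F).toMonoidHom) * ((unramifiedTwist F 1 : QuasiChar F).toMonoidHom)).comp ((Matrix.GeneralLinearGroup.det : GL {i : Fin 3 // (![false, false, true] : Fin 3 → Bool) i = true} F →* Fˣ).comp (Pi.evalMonoidHom (fun t : Bool => GL {i : Fin 3 // (![false, false, true] : Fin 3 → Bool) i = t} F) true)))))).Coinvariants]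
    (hD : ∀ ζ : (Π t : Fin 3, GL {i : Fin 3 // (id : Fin 3 → Fin 3) i = t} F) → ℂ, finrank ℂ ↥(⨅ m, Module.End.maxGenEigenspace (Representation.normalizedJacquetGL F (id : Fin 3 → Fin 3) (Representation.parabolicIndGL F (![false, false, true] : Fin 3 → Bool) ((Representation.trivial ℂ (Π t : Bool, GL {i : Fin 3 // (![false, false, true] : Fin 3 → Bool) i = t} F) ℂ).twist ((a * ((unramifiedTwist F (1 / 2) : QuasiChar F).toMonoidHom)).comp ((Matrix.GeneralLinearGroup.det : GL {i : Fin 3 // (![false, false, true] : Fin 3 → Bool) i = false} F →* Fˣ).comp (Pi.evalMonoidHom (fun t : Bool => GL {i : Fin 3 // (![false, false, true] : Fin 3 → Bool) i = t} F) false)) * (a * ((unramifiedTwist F 1 : QuasiChar F).toMonoidHom) * ((unramifiedTwist F 1 : QuasiChar F).toMonoidHom)).comp ((Matrix.GeneralLinearGroup.det : GL {i : Fin 3 // (![false, false, true] : Fin 3 → Bool) i = true} F →* Fˣ).comp (Pi.evalMonoidHom (fun t : Bool => GL {i : Fin 3 // (![false, false, true] : Fin 3 → Bool) i = t} F) true)))))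 m) (ζ m)) =
      (if ζ = (fun m : (Π t : Fin 3, GL {i : Fin 3 // (id : Fin 3 → Fin 3) i = t} F) => ((((∏ i : Fin 3, ((![a, a * ((unramifiedTwist F 1 : QuasiChar F).toMonoidHom), a * ((unramifiedTwist F 1 : QuasiChar F).toMonoidHom) * ((unramifiedTwist F 1 : QuasiChar F).toMonoidHom)] : Fin 3 → (Fˣ →* ℂˣ)) i).comp (Matrix.GeneralLinearGroup.det.comp (Pi.evalMonoidHom (fun t : Fin 3 => GL {i : Fin 3 // (id : Fin 3 → Fin 3) i = t} F) i)))) m : ℂˣ) : ℂ)) then 1 else 0) + (if ζ = (fun m : (Π t : Fin 3, GL {i : Fin 3 // (id : Fin 3 → Fin 3) i = t} F) => ((((∏ i : Fin 3, ((![a, a * ((unramifiedTwist F 1 : QuasiChar F).toMonoidHom) * ((unramifiedTwist F 1 : QuasiChar F).toMonoidHom), a * ((unramifiedTwist F 1 : QuasiChar F).toMonoidHom)] : Fin 3 → (Fˣ →* ℂˣ)) i).comp (Matrix.GeneralLinearGroup.det.comp (Pi.evalMonoidHom (fun t : Fin 3 => GL {i : Fin 3 // (id : Fin 3 → Fin 3)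 i = t} F) i)))) m : ℂˣ) : ℂ)) then 1 else 0) + (if ζ = (fun m : (Π t : Fin 3, GL {i : Fin 3 // (id : Fin 3 → Fin 3) i = t} F) => ((((∏ i : Fin 3, ((![a * ((unramifiedTwist F 1 : QuasiChar F).toMonoidHom) * ((unramifiedTwist F 1 : QuasiChar F).toMonoidHom), a, a * ((unramifiedTwist F 1 : QuasiChar F).toMonoidHom)] : Fin 3 → (Fˣ →* ℂˣ)) i).comp (Matrix.GeneralLinearGroup.det.comp (Pi.evalMonoidHom (fun t : Fin 3 => GL {i : Fin 3 // (id : Fin 3 → Fin 3) i = t} F) i)))) m : ℂˣ) : ℂ)) then 1 else 0))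
    (ΦD : (Representation.parabolicIndGL F (![false, false, true] : Fin 3 → Bool) ((Representation.trivial ℂ (Π t : Bool, GL {i : Fin 3 // (![false, false, true] : Fin 3 → Bool) i = t} F) ℂ).twist ((a * ((unramifiedTwist F (1 / 2) : QuasiChar F).toMonoidHom)).comp ((Matrix.GeneralLinearGroup.det : GL {i : Fin 3 // (![false, false, true] : Fin 3 → Bool) i = false} F →* Fˣ).comp (Pi.evalMonoidHom (fun t : Bool => GL {i : Fin 3 // (![false, false, true] : Fin 3 → Bool) i = t} F) false)) * (a * ((unramifiedTwist F 1 : QuasiChar F).toMonoidHom) * ((unramifiedTwist F 1 : QuasiChar F).toMonoidHom)).comp ((Matrix.GeneralLinearGroup.det : GL {i : Fin 3 // (![false, false, true] : Fin 3 → Bool) i = true} F →* Fˣ).comp (Pi.evalMonoidHom (fun t : Bool => GL {i : Fin 3 // (![false, false, true] : Fin 3 → Bool) i = t} F) true))))).IntertwiningMap (Representation.parabolicIndGL F (id : Fin 3 → Fin 3) ((Representation.trivial ℂ (Π t : Fin 3, GL {i : Fin 3 // (id : Fin 3 → Fin 3) i = t} F) ℂ).twist (∏ i : Fin 3, ((![a,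 a * ((unramifiedTwist F 1 : QuasiChar F).toMonoidHom), a * ((unramifiedTwist F 1 : QuasiChar F).toMonoidHom) * ((unramifiedTwist F 1 : QuasiChar F).toMonoidHom)] : Fin 3 → (Fˣ →* ℂˣ)) i).comp (Matrix.GeneralLinearGroup.det.comp (Pi.evalMonoidHom (fun t : Fin 3 => GL {i : Fin 3 // (id : Fin 3 → Fin 3) i = t} F) i)))))) (hΦD : Function.Injective ΦD) :
    finrank ℂ ↥(⨅ m, Module.End.maxGenEigenspace (Representation.normalizedJacquetGL F (id : Fin 3 → Fin 3) ΦD.range.quotientRep m) (((((∏ i : Fin 3, ((![a * ((unramifiedTwist F 1 : QuasiChar F).toMonoidHom) * ((unramifiedTwist F 1 : QuasiChar F).toMonoidHom), a * ((unramifiedTwist F 1 : QuasiChar F).toMonoidHom), a] : Fin 3 → (Fˣ →* ℂˣ)) i).comp (Matrix.GeneralLinearGroup.det.comp (Pi.evalMonoidHom (fun t : Fin 3 => GL {i : Fin 3 // (id : Fin 3 → Fin 3) i = t} F) i)))) m : ℂˣ) : ℂ))) = 1 ∧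
    finrank ℂ ↥(⨅ m, Module.End.maxGenEigenspace (Representation.normalizedJacquetGL F (id : Fin 3 → Fin 3) ΦD.range.quotientRep m) (((((∏ i : Fin 3, ((![a * ((unramifiedTwist F 1 : QuasiChar F).toMonoidHom), a, a * ((unramifiedTwist F 1 : QuasiChar F).toMonoidHom) * ((unramifiedTwist F 1 : QuasiChar F).toMonoidHom)] : Fin 3 → (Fˣ →* ℂˣ)) i).comp (Matrix.GeneralLinearGroup.det.comp (Pi.evalMonoidHom (fun t : Fin 3 => GL {i : Fin 3 // (id : Fin 3 → Fin 3) i = t} F) i)))) m : ℂˣ) : ℂ))) = 1 ∧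
    finrank ℂ ↥(⨅ m, Module.End.maxGenEigenspace (Representation.normalizedJacquetGL F (id : Fin 3 → Fin 3) ΦD.range.quotientRep m) (((((∏ i : Fin 3, ((![a * ((unramifiedTwist F 1 : QuasiChar F).toMonoidHom), a * ((unramifiedTwist F 1 : QuasiChar F).toMonoidHom) * ((unramifiedTwist F 1 : QuasiChar F).toMonoidHom), a] : Fin 3 → (Fˣ →* ℂˣ)) i).comp (Matrix.GeneralLinearGroup.det.comp (Pi.evalMonoidHom (fun t : Fin 3 => GL {i : Fin 3 // (id : Fin 3 → Fin 3) i = t} F) i)))) m : ℂˣ) : ℂ))) = 1 := by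
  have h_ob := cube_letters_ne a
  obtain ⟨h1, h2, h3, -⟩ := h_ob
  have h_ob := isOpen_ker_letters a ha
  obtain ⟨ha1, ha2⟩ := h_ob
  have hIs : (Representation.parabolicIndGL F (id : Fin 3 → Fin 3) ((Representation.trivial ℂ (Π t : Fin 3, GL {i : Fin 3 // (id : Fin 3 → Fin 3) i = t} F) ℂ).twist (∏ i : Fin 3, ((![a, a * ((unramifiedTwist F 1 : QuasiChar F).toMonoidHom), a * ((unramifiedTwist F 1 : QuasiChar F).toMonoidHom) * ((unramifiedTwist F 1 : QuasiChar F).toMonoidHom)] : Fin 3 → (Fˣ →* ℂˣ)) i).comp (Matrix.GeneralLinearGroup.det.comp (Pi.evalMonoidHom (fun t : Fin 3 => GL {i : Fin 3 // (id : Fin 3 → Fin 3) i = t} F) i))))).IsSmooth := isSmooth_principalSeries _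
  haveI : FiniteDimensional ℂ (Representation.restrictUnipotentGL F (id : Fin 3 → Fin 3) (Representation.parabolicIndGL F (id : Fin 3 → Fin 3) ((Representation.trivial ℂ (Π t : Fin 3, GL {i : Fin 3 // (id : Fin 3 → Fin 3) i = t} F) ℂ).twist (∏ i : Fin 3, ((![a, a * ((unramifiedTwist F 1 : QuasiChar F).toMonoidHom), a * ((unramifiedTwist F 1 : QuasiChar F).toMonoidHom) * ((unramifiedTwist F 1 : QuasiChar F).toMonoidHom)] : Fin 3 → (Fˣ →* ℂˣ)) i).comp (Matrix.GeneralLinearGroup.det.comp (Pi.evalMonoidHom (fun t : Fin 3 => GL {i : Fin 3 // (id : Fin 3 → Fin 3) i = t} F) i)))))).Coinvariants := finiteDimensional_jacquet_principalSeries _ (isOpen_ker_tch_three _ _ _ ha ha1 ha2)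
  have h_ob := nonempty_equiv_range ΦD hΦD
  obtain ⟨e⟩ := h_ob
  have hadd := fun ζ => finrank_weightSpace_eq_add_subrepresentation (Representation.parabolicIndGL F (id : Fin 3 → Fin 3) ((Representation.trivial ℂ (Π t : Fin 3, GL {i : Fin 3 // (id : Fin 3 → Fin 3) i = t} F) ℂ).twist (∏ i : Fin 3, ((![a, a * ((unramifiedTwist F 1 : QuasiChar F).toMonoidHom), a * ((unramifiedTwist F 1 : QuasiChar F).toMonoidHom) * ((unramifiedTwist F 1 : QuasiChar F).toMonoidHom)] : Fin 3 → (Fˣ →* ℂˣ)) i).comp (Matrix.GeneralLinearGroup.det.comp (Pi.evalMonoidHom (fun t : Fin 3 => GL {i : Fin 3 // (id : Fin 3 → Fin 3) i = t} F) i))))) hIs ΦD.range ζ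
  have hN := fun ζ : (Π t : Fin 3, GL {i : Fin 3 // (id : Fin 3 → Fin 3) i = t} F) → ℂ => finrank_weightSpace_eq_of_equiv _ _ e ζ
  have h_ob := table_D a hD
  obtain ⟨hD1, hD3, hD3p, hD0⟩ := h_ob
  -- the table of `I C₁` at the six orderings (★ REG via ★ C2b-wt)
  have hI := fun (σ : Equiv.Perm (Fin 3)) (θ' : Fin 3 → (Fˣ →* ℂˣ)) (hθ' : ∀ i, θ' i = (![a, a * ((unramifiedTwist F 1 : QuasiChar F).toMonoidHom), a * ((unramifiedTwist F 1 : QuasiChar F).toMonoidHom) * ((unramifiedTwist F 1 : QuasiChar F).toMonoidHom)] : Fin 3 → (Fˣ →* ℂˣ)) (σ.symm i)) =>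
    finrank_weightSpace_I_three_perm_eq_one _ _ _ ha ha1 ha2 (injective_cube_orderings a).1 σ θ' hθ'
  have hI2 := hI (Equiv.swap 0 2) (![a * ((unramifiedTwist F 1 : QuasiChar F).toMonoidHom) * ((unramifiedTwist F 1 : QuasiChar F).toMonoidHom), a * ((unramifiedTwist F 1 : QuasiChar F).toMonoidHom), a] : Fin 3 → (Fˣ →* ℂˣ)) (fun i => by fin_cases i <;> rfl); have hI4 := hI (Equiv.swap 0 1) (![a * ((unramifiedTwist F 1 : QuasiChar F).toMonoidHom), a, a * ((unramifiedTwist F 1 : QuasiChar F).toMonoidHom) * ((unramifiedTwist F 1 : QuasiChar F).toMonoidHom)] : Fin 3 → (Fˣ →* ℂˣ)) (fun i => by fin_cases i <;> rfl); have hI4p := hI (Equiv.swap 1 2 * Equiv.swap 0 1) (![a * ((unramifiedTwist F 1 : QuasiChar F).toMonoidHom), a * ((unramifiedTwist F 1 : QuasiChar F).toMonoidHom) * ((unramifiedTwist F 1 : QuasiChar F).toMonoidHom), a] : Fin 3 → (Fˣ →* ℂˣ)) (fun i => by fin_cases i <;> rfl)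
  have n21 : (fun m : (Π t : Fin 3, GL {i : Fin 3 // (id : Fin 3 → Fin 3) i = t} F) => ((((∏ i : Fin 3, ((![a * ((unramifiedTwist F 1 : QuasiChar F).toMonoidHom) * ((unramifiedTwist F 1 : QuasiChar F).toMonoidHom), a * ((unramifiedTwist F 1 : QuasiChar F).toMonoidHom), a] : Fin 3 → (Fˣ →* ℂˣ)) i).comp (Matrix.GeneralLinearGroup.det.comp (Pi.evalMonoidHom (fun t : Fin 3 => GL {i : Fin 3 // (id : Fin 3 → Fin 3) i = t} F) i)))) m : ℂˣ) : ℂ)) ≠ (fun m : (Π t : Fin 3, GL {i : Fin 3 // (id : Fin 3 → Fin 3) i = t} F) => ((((∏ i : Fin 3, ((![a, a * ((unramifiedTwist F 1 : QuasiChar F).toMonoidHom), a * ((unramifiedTwist F 1 : QuasiChar F).toMonoidHom) * ((unramifiedTwist F 1 : QuasiChar F).toMonoidHom)] : Fin 3 → (Fˣ →* ℂˣ)) i).comp (Matrix.GeneralLinearGroup.det.comp (Pi.evalMonoidHom (fun t : Fin 3 => GL {i : Fin 3 // (id : Fin 3 → Fin 3) i = t} F) i)))) m : ℂˣ) : ℂ))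 := wt_ne_of_apply_ne _ _ 0 (by simpa using h2); have n23 : (fun m : (Π t : Fin 3, GL {i : Fin 3 // (id : Fin 3 → Fin 3) i = t} F) => ((((∏ i : Fin 3, ((![a * ((unramifiedTwist F 1 : QuasiChar F).toMonoidHom) * ((unramifiedTwist F 1 : QuasiChar F).toMonoidHom), a * ((unramifiedTwist F 1 : QuasiChar F).toMonoidHom), a] : Fin 3 → (Fˣ →* ℂˣ)) i).comp (Matrix.GeneralLinearGroup.det.comp (Pi.evalMonoidHom (fun t : Fin 3 => GL {i : Fin 3 // (id : Fin 3 → Fin 3) i = t} F) i)))) m : ℂˣ) : ℂ)) ≠ (fun m : (Π t : Fin 3, GL {i : Fin 3 // (id : Fin 3 → Fin 3) i = t} F) => ((((∏ i : Fin 3, ((![a, a * ((unramifiedTwist F 1 : QuasiChar F).toMonoidHom) * ((unramifiedTwist F 1 : QuasiChar F).toMonoidHom), a * ((unramifiedTwist F 1 : QuasiChar F).toMonoidHom)] : Fin 3 → (Fˣ →* ℂˣ)) i).comp (Matrix.GeneralLinearGroup.det.comp (Pi.evalMonoidHom (fun t : Fin 3 => GL {i : Fin 3 // (id : Fin 3 →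 Fin 3) i = t} F) i)))) m : ℂˣ) : ℂ)) := wt_ne_of_apply_ne _ _ 0 (by simpa using h2); have n23p : (fun m : (Π t : Fin 3, GL {i : Fin 3 // (id : Fin 3 → Fin 3) i = t} F) => ((((∏ i : Fin 3, ((![a * ((unramifiedTwist F 1 : QuasiChar F).toMonoidHom) * ((unramifiedTwist F 1 : QuasiChar F).toMonoidHom), a * ((unramifiedTwist F 1 : QuasiChar F).toMonoidHom), a] : Fin 3 → (Fˣ →* ℂˣ)) i).comp (Matrix.GeneralLinearGroup.det.comp (Pi.evalMonoidHom (fun t : Fin 3 => GL {i : Fin 3 // (id : Fin 3 → Fin 3) i = t} F) i)))) m : ℂˣ) : ℂ)) ≠ (fun m : (Π t : Fin 3, GL {i : Fin 3 // (id : Fin 3 → Fin 3) i = t} F) => ((((∏ i : Fin 3, ((![a * ((unramifiedTwist F 1 : QuasiChar F).toMonoidHom) * ((unramifiedTwist F 1 : QuasiChar F).toMonoidHom), a, a * ((unramifiedTwist F 1 : QuasiChar F).toMonoidHom)] : Fin 3 → (Fˣ →* ℂˣ)) i).comp (Matrix.GeneralLinearGroup.det.comp (Pi.evalMonoidHom (fun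 t : Fin 3 => GL {i : Fin 3 // (id : Fin 3 → Fin 3) i = t} F) i)))) m : ℂˣ) : ℂ)) := wt_ne_of_apply_ne _ _ 1 (by simpa using h1)
  have n41 : (fun m : (Π t : Fin 3, GL {i : Fin 3 // (id : Fin 3 → Fin 3) i = t} F) => ((((∏ i : Fin 3, ((![a * ((unramifiedTwist F 1 : QuasiChar F).toMonoidHom), a, a * ((unramifiedTwist F 1 : QuasiChar F).toMonoidHom) * ((unramifiedTwist F 1 : QuasiChar F).toMonoidHom)] : Fin 3 → (Fˣ →* ℂˣ)) i).comp (Matrix.GeneralLinearGroup.det.comp (Pi.evalMonoidHom (fun t : Fin 3 => GL {i : Fin 3 // (id : Fin 3 → Fin 3) i = t} F) i)))) m : ℂˣ) : ℂ)) ≠ (fun m : (Π t : Fin 3, GL {i : Fin 3 // (id : Fin 3 → Fin 3) i = t} F) => ((((∏ i : Fin 3, ((![a, a * ((unramifiedTwist F 1 : QuasiChar F).toMonoidHom), a * ((unramifiedTwist F 1 : QuasiChar F).toMonoidHom) * ((unramifiedTwist F 1 : QuasiChar F).toMonoidHom)] : Fin 3 → (Fˣ →* ℂˣ)) i).comp (Matrix.GeneralLinearGroup.det.comp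 (Pi.evalMonoidHom (fun t : Fin 3 => GL {i : Fin 3 // (id : Fin 3 → Fin 3) i = t} F) i)))) m : ℂˣ) : ℂ)) := wt_ne_of_apply_ne _ _ 0 (by simpa using h1); have n43 : (fun m : (Π t : Fin 3, GL {i : Fin 3 // (id : Fin 3 → Fin 3) i = t} F) => ((((∏ i : Fin 3, ((![a * ((unramifiedTwist F 1 : QuasiChar F).toMonoidHom), a, a * ((unramifiedTwist F 1 : QuasiChar F).toMonoidHom) * ((unramifiedTwist F 1 : QuasiChar F).toMonoidHom)] : Fin 3 → (Fˣ →* ℂˣ)) i).comp (Matrix.GeneralLinearGroup.det.comp (Pi.evalMonoidHom (fun t : Fin 3 => GL {i : Fin 3 // (id : Fin 3 → Fin 3) i = t} F) i)))) m : ℂˣ) : ℂ)) ≠ (fun m : (Π t : Fin 3, GL {i : Fin 3 // (id : Fin 3 → Fin 3) i = t} F) => ((((∏ i : Fin 3, ((![a, a * ((unramifiedTwist F 1 : QuasiChar F).toMonoidHom) * ((unramifiedTwist F 1 : QuasiChar F).toMonoidHom), a * ((unramifiedTwist F 1 : QuasiChar F).toMonoidHom)] : Fin 3 → (Fˣ →*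 ℂˣ)) i).comp (Matrix.GeneralLinearGroup.det.comp (Pi.evalMonoidHom (fun t : Fin 3 => GL {i : Fin 3 // (id : Fin 3 → Fin 3) i = t} F) i)))) m : ℂˣ) : ℂ)) := wt_ne_of_apply_ne _ _ 0 (by simpa using h1); have n43p : (fun m : (Π t : Fin 3, GL {i : Fin 3 // (id : Fin 3 → Fin 3) i = t} F) => ((((∏ i : Fin 3, ((![a * ((unramifiedTwist F 1 : QuasiChar F).toMonoidHom), a, a * ((unramifiedTwist F 1 : QuasiChar F).toMonoidHom) * ((unramifiedTwist F 1 : QuasiChar F).toMonoidHom)] : Fin 3 → (Fˣ →* ℂˣ)) i).comp (Matrix.GeneralLinearGroup.det.comp (Pi.evalMonoidHom (fun t : Fin 3 => GL {i : Fin 3 // (id : Fin 3 → Fin 3) i = t} F) i)))) m : ℂˣ) : ℂ)) ≠ (fun m : (Π t : Fin 3, GL {i : Fin 3 // (id : Fin 3 → Fin 3) i = t} F) => ((((∏ i : Fin 3, ((![a * ((unramifiedTwist F 1 : QuasiChar F).toMonoidHom) * ((unramifiedTwist F 1 : QuasiChar F).toMonoidHom), a, a * ((unramifiedTwist F 1 :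 QuasiChar F).toMonoidHom)] : Fin 3 → (Fˣ →* ℂˣ)) i).comp (Matrix.GeneralLinearGroup.det.comp (Pi.evalMonoidHom (fun t : Fin 3 => GL {i : Fin 3 // (id : Fin 3 → Fin 3) i = t} F) i)))) m : ℂˣ) : ℂ)) := wt_ne_of_apply_ne _ _ 0 (by simpa using h3.symm)
  have n4p1 : (fun m : (Π t : Fin 3, GL {i : Fin 3 // (id : Fin 3 → Fin 3) i = t} F) => ((((∏ i : Fin 3, ((![a * ((unramifiedTwist F 1 : QuasiChar F).toMonoidHom), a * ((unramifiedTwist F 1 : QuasiChar F).toMonoidHom) * ((unramifiedTwist F 1 : QuasiChar F).toMonoidHom), a] : Fin 3 → (Fˣ →* ℂˣ)) i).comp (Matrix.GeneralLinearGroup.det.comp (Pi.evalMonoidHom (fun t : Fin 3 => GL {i : Fin 3 // (id : Fin 3 → Fin 3) i = t} F) i)))) m : ℂˣ) : ℂ)) ≠ (fun m : (Π t : Fin 3, GL {i : Fin 3 // (id : Fin 3 → Fin 3) i = t} F) => ((((∏ i : Fin 3, ((![a, a * ((unramifiedTwist F 1 : QuasiChar F).toMonoidHom), a * ((unramifiedTwist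 F 1 : QuasiChar F).toMonoidHom) * ((unramifiedTwist F 1 : QuasiChar F).toMonoidHom)] : Fin 3 → (Fˣ →* ℂˣ)) i).comp (Matrix.GeneralLinearGroup.det.comp (Pi.evalMonoidHom (fun t : Fin 3 => GL {i : Fin 3 // (id : Fin 3 → Fin 3) i = t} F) i)))) m : ℂˣ) : ℂ)) := wt_ne_of_apply_ne _ _ 0 (by simpa using h1); have n4p3 : (fun m : (Π t : Fin 3, GL {i : Fin 3 // (id : Fin 3 → Fin 3) i = t} F) => ((((∏ i : Fin 3, ((![a * ((unramifiedTwist F 1 : QuasiChar F).toMonoidHom), a * ((unramifiedTwist F 1 : QuasiChar F).toMonoidHom) * ((unramifiedTwist F 1 : QuasiChar F).toMonoidHom), a] : Fin 3 → (Fˣ →* ℂˣ)) i).comp (Matrix.GeneralLinearGroup.det.comp (Pi.evalMonoidHom (fun t : Fin 3 => GL {i : Fin 3 // (id : Fin 3 → Fin 3) i = t} F) i)))) m : ℂˣ) : ℂ)) ≠ (fun m : (Π t : Fin 3, GL {i : Fin 3 // (id : Fin 3 → Fin 3) i = t} F) => ((((∏ i : Fin 3, ((![a, a * ((unramifiedTwist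 F 1 : QuasiChar F).toMonoidHom) * ((unramifiedTwist F 1 : QuasiChar F).toMonoidHom), a * ((unramifiedTwist F 1 : QuasiChar F).toMonoidHom)] : Fin 3 → (Fˣ →* ℂˣ)) i).comp (Matrix.GeneralLinearGroup.det.comp (Pi.evalMonoidHom (fun t : Fin 3 => GL {i : Fin 3 // (id : Fin 3 → Fin 3) i = t} F) i)))) m : ℂˣ) : ℂ)) := wt_ne_of_apply_ne _ _ 0 (by simpa using h1); have n4p3p : (fun m : (Π t : Fin 3, GL {i : Fin 3 // (id : Fin 3 → Fin 3) i = t} F) => ((((∏ i : Fin 3, ((![a * ((unramifiedTwist F 1 : QuasiChar F).toMonoidHom), a * ((unramifiedTwist F 1 : QuasiChar F).toMonoidHom) * ((unramifiedTwist F 1 : QuasiChar F).toMonoidHom), a] : Fin 3 → (Fˣ →* ℂˣ)) i).comp (Matrix.GeneralLinearGroup.det.comp (Pi.evalMonoidHom (fun t : Fin 3 => GL {i : Fin 3 // (id : Fin 3 → Fin 3) i = t} F) i)))) m : ℂˣ) : ℂ)) ≠ (fun m : (Π t : Fin 3, GL {i : Fin 3 // (id : Fin 3 → Fin 3) i = t}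 F) => ((((∏ i : Fin 3, ((![a * ((unramifiedTwist F 1 : QuasiChar F).toMonoidHom) * ((unramifiedTwist F 1 : QuasiChar F).toMonoidHom), a, a * ((unramifiedTwist F 1 : QuasiChar F).toMonoidHom)] : Fin 3 → (Fˣ →* ℂˣ)) i).comp (Matrix.GeneralLinearGroup.det.comp (Pi.evalMonoidHom (fun t : Fin 3 => GL {i : Fin 3 // (id : Fin 3 → Fin 3) i = t} F) i)))) m : ℂˣ) : ℂ)) := wt_ne_of_apply_ne _ _ 0 (by simpa using h3.symm)
  refine ⟨?_, ?_, ?_⟩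
  · have e1 := hadd (fun m : (Π t : Fin 3, GL {i : Fin 3 // (id : Fin 3 → Fin 3) i = t} F) => ((((∏ i : Fin 3, ((![a * ((unramifiedTwist F 1 : QuasiChar F).toMonoidHom) * ((unramifiedTwist F 1 : QuasiChar F).toMonoidHom), a * ((unramifiedTwist F 1 : QuasiChar F).toMonoidHom), a] : Fin 3 → (Fˣ →* ℂˣ)) i).comp (Matrix.GeneralLinearGroup.det.comp (Pi.evalMonoidHom (fun t : Fin 3 => GL {i : Fin 3 // (id : Fin 3 → Fin 3) i = t} F) i)))) m : ℂˣ) : ℂ)); have e2 := hN (fun m : (Π t : Fin 3, GL {i : Fin 3 // (id : Fin 3 → Fin 3) i = t} F) => ((((∏ i : Fin 3, ((![a * ((unramifiedTwist F 1 : QuasiChar F).toMonoidHom) * ((unramifiedTwist F 1 : QuasiChar F).toMonoidHom), a * ((unramifiedTwist F 1 : QuasiChar F).toMonoidHom), a] : Fin 3 → (Fˣ →* ℂˣ)) i).comp (Matrix.GeneralLinearGroup.det.comp (Pi.evalMonoidHom (fun t : Fin 3 => GL {i : Fin 3 // (id : Fin 3 → Fin 3) i = t} F) i)))) m : ℂˣ)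 : ℂ)); have e3 := hD0 _ n21 n23 n23p
    linarith only [e1, e2, e3, hI2]
  · have e1 := hadd (fun m : (Π t : Fin 3, GL {i : Fin 3 // (id : Fin 3 → Fin 3) i = t} F) => ((((∏ i : Fin 3, ((![a * ((unramifiedTwist F 1 : QuasiChar F).toMonoidHom), a, a * ((unramifiedTwist F 1 : QuasiChar F).toMonoidHom) * ((unramifiedTwist F 1 : QuasiChar F).toMonoidHom)] : Fin 3 → (Fˣ →* ℂˣ)) i).comp (Matrix.GeneralLinearGroup.det.comp (Pi.evalMonoidHom (fun t : Fin 3 => GL {i : Fin 3 // (id : Fin 3 → Fin 3) i = t} F) i)))) m : ℂˣ) : ℂ)); have e2 := hN (fun m : (Π t : Fin 3, GL {i : Fin 3 // (id : Fin 3 → Fin 3) i = t} F) => ((((∏ i : Fin 3, ((![a * ((unramifiedTwist F 1 : QuasiChar F).toMonoidHom), a, a * ((unramifiedTwist F 1 : QuasiChar F).toMonoidHom) * ((unramifiedTwist F 1 : QuasiChar F).toMonoidHom)] : Fin 3 → (Fˣ →* ℂˣ)) i).comp (Matrix.GeneralLinearGroup.det.comp (Pi.evalMonoidHom (fun t : Fin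 3 => GL {i : Fin 3 // (id : Fin 3 → Fin 3) i = t} F) i)))) m : ℂˣ) : ℂ)); have e3 := hD0 _ n41 n43 n43p
    linarith only [e1, e2, e3, hI4]
  · have e1 := hadd (fun m : (Π t : Fin 3, GL {i : Fin 3 // (id : Fin 3 → Fin 3) i = t} F) => ((((∏ i : Fin 3, ((![a * ((unramifiedTwist F 1 : QuasiChar F).toMonoidHom), a * ((unramifiedTwist F 1 : QuasiChar F).toMonoidHom) * ((unramifiedTwist F 1 : QuasiChar F).toMonoidHom), a] : Fin 3 → (Fˣ →* ℂˣ)) i).comp (Matrix.GeneralLinearGroup.det.comp (Pi.evalMonoidHom (fun t : Fin 3 => GL {i : Fin 3 // (id : Fin 3 → Fin 3) i = t} F) i)))) m : ℂˣ) : ℂ)); have e2 := hN (fun m : (Π t : Fin 3, GL {i : Fin 3 // (id : Fin 3 → Fin 3) i = t} F) => ((((∏ i : Fin 3, ((![a * ((unramifiedTwist F 1 : QuasiChar F).toMonoidHom), a * ((unramifiedTwist F 1 : QuasiChar F).toMonoidHom) * ((unramifiedTwist F 1 : QuasiChar F).toMonoidHom), a] : Fin 3 → (Fˣ →* ℂˣ))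 i).comp (Matrix.GeneralLinearGroup.det.comp (Pi.evalMonoidHom (fun t : Fin 3 => GL {i : Fin 3 // (id : Fin 3 → Fin 3) i = t} F) i)))) m : ℂˣ) : ℂ)); have e3 := hD0 _ n4p1 n4p3 n4p3p
    linarith only [e1, e2, e3, hI4p]

include ha in
/-- **`E(I C₁ ⁄ D)`, vanishing part**: `mult (I C₁ ⁄ range Φ_D) ζ = 0` for every `ζ` off `{{wt C₂, wt C₄, wt C₄′}}`. [cite: Zelevinsky1980, §1, §9] [cite: BernsteinZelevinsky1977, Thm. 5.2, §2.3] -/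
theorem weights_quotient_I_D_zero [FiniteDimensional ℂ (Representation.restrictUnipotentGL F (id : Fin 3 → Fin 3) (Representation.parabolicIndGL F (![false, false, true] : Fin 3 → Bool) ((Representation.trivial ℂ (Π t : Bool, GL {i : Fin 3 // (![false, false, true] : Fin 3 → Bool) i = t} F) ℂ).twist ((a * ((unramifiedTwist F (1 / 2) : QuasiChar F).toMonoidHom)).comp ((Matrix.GeneralLinearGroup.det : GL {i : Fin 3 // (![false, false, true] : Fin 3 → Bool) i = false} F →* Fˣ).comp (Pi.evalMonoidHom (fun t : Bool => GL {i : Fin 3 // (![false, false, true] : Fin 3 → Bool) i = t} F) false)) * (a * ((unramifiedTwist F 1 : QuasiChar F).toMonoidHom) * ((unramifiedTwist F 1 : QuasiChar F).toMonoidHom)).comp ((Matrix.GeneralLinearGroup.det : GL {i : Fin 3 // (![false, false, true] : Fin 3 → Bool) i = true} F →* Fˣ).comp (Pi.evalMonoidHom (fun t : Bool => GL {i : Fin 3 // (![false, false, true] : Fin 3 → Bool) i = t} F) true)))))).Coinvariants]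
    (hD : ∀ ζ : (Π t : Fin 3, GL {i : Fin 3 // (id : Fin 3 → Fin 3) i = t} F) → ℂ, finrank ℂ ↥(⨅ m, Module.End.maxGenEigenspace (Representation.normalizedJacquetGL F (id : Fin 3 → Fin 3) (Representation.parabolicIndGL F (![false, false, true] : Fin 3 → Bool) ((Representation.trivial ℂ (Π t : Bool, GL {i : Fin 3 // (![false, false, true] : Fin 3 → Bool) i = t} F) ℂ).twist ((a * ((unramifiedTwist F (1 / 2) : QuasiChar F).toMonoidHom)).comp ((Matrix.GeneralLinearGroup.det : GL {i : Fin 3 // (![false, false, true] : Fin 3 → Bool) i = false} F →* Fˣ).comp (Pi.evalMonoidHom (fun t : Bool => GL {i : Fin 3 // (![false, false, true] : Fin 3 → Bool) i = t} F) false)) * (a * ((unramifiedTwist F 1 : QuasiChar F).toMonoidHom) * ((unramifiedTwist F 1 : QuasiChar F).toMonoidHom)).comp ((Matrix.GeneralLinearGroup.det : GL {i : Fin 3 // (![false, false, true] : Fin 3 → Bool) i = true} F →* Fˣ).comp (Pi.evalMonoidHom (fun t : Bool => GL {i : Fin 3 // (![false, false, true] : Fin 3 → Bool) i = t} F) true)))))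 m) (ζ m)) =
      (if ζ = (fun m : (Π t : Fin 3, GL {i : Fin 3 // (id : Fin 3 → Fin 3) i = t} F) => ((((∏ i : Fin 3, ((![a, a * ((unramifiedTwist F 1 : QuasiChar F).toMonoidHom), a * ((unramifiedTwist F 1 : QuasiChar F).toMonoidHom) * ((unramifiedTwist F 1 : QuasiChar F).toMonoidHom)] : Fin 3 → (Fˣ →* ℂˣ)) i).comp (Matrix.GeneralLinearGroup.det.comp (Pi.evalMonoidHom (fun t : Fin 3 => GL {i : Fin 3 // (id : Fin 3 → Fin 3) i = t} F) i)))) m : ℂˣ) : ℂ)) then 1 else 0) + (if ζ = (fun m : (Π t : Fin 3, GL {i : Fin 3 // (id : Fin 3 → Fin 3) i = t} F) => ((((∏ i : Fin 3, ((![a, a * ((unramifiedTwist F 1 : QuasiChar F).toMonoidHom) * ((unramifiedTwist F 1 : QuasiChar F).toMonoidHom), a * ((unramifiedTwist F 1 : QuasiChar F).toMonoidHom)] : Fin 3 → (Fˣ →* ℂˣ)) i).comp (Matrix.GeneralLinearGroup.det.comp (Pi.evalMonoidHom (fun t : Fin 3 => GL {i : Fin 3 // (id : Fin 3 → Fin 3)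 i = t} F) i)))) m : ℂˣ) : ℂ)) then 1 else 0) + (if ζ = (fun m : (Π t : Fin 3, GL {i : Fin 3 // (id : Fin 3 → Fin 3) i = t} F) => ((((∏ i : Fin 3, ((![a * ((unramifiedTwist F 1 : QuasiChar F).toMonoidHom) * ((unramifiedTwist F 1 : QuasiChar F).toMonoidHom), a, a * ((unramifiedTwist F 1 : QuasiChar F).toMonoidHom)] : Fin 3 → (Fˣ →* ℂˣ)) i).comp (Matrix.GeneralLinearGroup.det.comp (Pi.evalMonoidHom (fun t : Fin 3 => GL {i : Fin 3 // (id : Fin 3 → Fin 3) i = t} F) i)))) m : ℂˣ) : ℂ)) then 1 else 0))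
    (ΦD : (Representation.parabolicIndGL F (![false, false, true] : Fin 3 → Bool) ((Representation.trivial ℂ (Π t : Bool, GL {i : Fin 3 // (![false, false, true] : Fin 3 → Bool) i = t} F) ℂ).twist ((a * ((unramifiedTwist F (1 / 2) : QuasiChar F).toMonoidHom)).comp ((Matrix.GeneralLinearGroup.det : GL {i : Fin 3 // (![false, false, true] : Fin 3 → Bool) i = false} F →* Fˣ).comp (Pi.evalMonoidHom (fun t : Bool => GL {i : Fin 3 // (![false, false, true] : Fin 3 → Bool) i = t} F) false)) * (a * ((unramifiedTwist F 1 : QuasiChar F).toMonoidHom) * ((unramifiedTwist F 1 : QuasiChar F).toMonoidHom)).comp ((Matrix.GeneralLinearGroup.det : GL {i : Fin 3 // (![false, false, true] : Fin 3 → Bool) i = true} F →* Fˣ).comp (Pi.evalMonoidHom (fun t : Bool => GL {i : Fin 3 // (![false, false, true] : Fin 3 → Bool) i = t} F) true))))).IntertwiningMap (Representation.parabolicIndGL F (id : Fin 3 → Fin 3) ((Representation.trivial ℂ (Π t : Fin 3, GL {i : Fin 3 // (id : Fin 3 → Fin 3) i = t} F) ℂ).twist (∏ i : Fin 3, ((![a,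 a * ((unramifiedTwist F 1 : QuasiChar F).toMonoidHom), a * ((unramifiedTwist F 1 : QuasiChar F).toMonoidHom) * ((unramifiedTwist F 1 : QuasiChar F).toMonoidHom)] : Fin 3 → (Fˣ →* ℂˣ)) i).comp (Matrix.GeneralLinearGroup.det.comp (Pi.evalMonoidHom (fun t : Fin 3 => GL {i : Fin 3 // (id : Fin 3 → Fin 3) i = t} F) i)))))) (hΦD : Function.Injective ΦD)
    (ζ : (Π t : Fin 3, GL {i : Fin 3 // (id : Fin 3 → Fin 3) i = t} F) → ℂ) (hζ2 : ζ ≠ (fun m : (Π t : Fin 3, GL {i : Fin 3 // (id : Fin 3 → Fin 3) i = t} F) => ((((∏ i : Fin 3, ((![a * ((unramifiedTwist F 1 : QuasiChar F).toMonoidHom) * ((unramifiedTwist F 1 : QuasiChar F).toMonoidHom), a * ((unramifiedTwist F 1 : QuasiChar F).toMonoidHom), a] : Fin 3 → (Fˣ →* ℂˣ)) i).comp (Matrix.GeneralLinearGroup.det.comp (Pi.evalMonoidHom (fun t : Fin 3 => GL {i : Fin 3 // (id : Fin 3 → Fin 3) i = t} F) i)))) m : ℂˣ) : ℂ))) (hζ4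 : ζ ≠ (fun m : (Π t : Fin 3, GL {i : Fin 3 // (id : Fin 3 → Fin 3) i = t} F) => ((((∏ i : Fin 3, ((![a * ((unramifiedTwist F 1 : QuasiChar F).toMonoidHom), a, a * ((unramifiedTwist F 1 : QuasiChar F).toMonoidHom) * ((unramifiedTwist F 1 : QuasiChar F).toMonoidHom)] : Fin 3 → (Fˣ →* ℂˣ)) i).comp (Matrix.GeneralLinearGroup.det.comp (Pi.evalMonoidHom (fun t : Fin 3 => GL {i : Fin 3 // (id : Fin 3 → Fin 3) i = t} F) i)))) m : ℂˣ) : ℂ))) (hζ4p : ζ ≠ (fun m : (Π t : Fin 3, GL {i : Fin 3 // (id : Fin 3 → Fin 3) i = t} F) => ((((∏ i : Fin 3, ((![a * ((unramifiedTwist F 1 : QuasiChar F).toMonoidHom), a * ((unramifiedTwist F 1 : QuasiChar F).toMonoidHom) * ((unramifiedTwist F 1 : QuasiChar F).toMonoidHom), a] : Fin 3 → (Fˣ →* ℂˣ)) i).comp (Matrix.GeneralLinearGroup.det.comp (Pi.evalMonoidHom (fun t : Fin 3 => GL {i : Fin 3 // (id : Fin 3 → Fin 3) i = t} F) i)))) m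 : ℂˣ) : ℂ))) :
    finrank ℂ ↥(⨅ m, Module.End.maxGenEigenspace (Representation.normalizedJacquetGL F (id : Fin 3 → Fin 3) ΦD.range.quotientRep m) (ζ m)) = 0 := by
  have h_ob := cube_letters_ne a
  obtain ⟨h1, h2, h3, -⟩ := h_ob
  have h_ob := isOpen_ker_letters a ha
  obtain ⟨ha1, ha2⟩ := h_ob
  have hIs : (Representation.parabolicIndGL F (id : Fin 3 → Fin 3) ((Representation.trivial ℂ (Π t : Fin 3, GL {i : Fin 3 // (id : Fin 3 → Fin 3) i = t} F) ℂ).twist (∏ i : Fin 3, ((![a, a * ((unramifiedTwist F 1 : QuasiChar F).toMonoidHom), a * ((unramifiedTwist F 1 : QuasiChar F).toMonoidHom) * ((unramifiedTwist F 1 : QuasiChar F).toMonoidHom)] : Fin 3 → (Fˣ →* ℂˣ)) i).comp (Matrix.GeneralLinearGroup.det.comp (Pi.evalMonoidHom (fun t : Fin 3 => GL {i : Fin 3 // (id : Fin 3 → Fin 3) i = t} F) i))))).IsSmooth := isSmooth_principalSeries _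
  haveI : FiniteDimensional ℂ (Representation.restrictUnipotentGL F (id : Fin 3 → Fin 3) (Representation.parabolicIndGL F (id : Fin 3 → Fin 3) ((Representation.trivial ℂ (Π t : Fin 3, GL {i : Fin 3 // (id : Fin 3 → Fin 3) i = t} F) ℂ).twist (∏ i : Fin 3, ((![a, a * ((unramifiedTwist F 1 : QuasiChar F).toMonoidHom), a * ((unramifiedTwist F 1 : QuasiChar F).toMonoidHom) * ((unramifiedTwist F 1 : QuasiChar F).toMonoidHom)] : Fin 3 → (Fˣ →* ℂˣ)) i).comp (Matrix.GeneralLinearGroup.det.comp (Pi.evalMonoidHom (fun t : Fin 3 => GL {i : Fin 3 // (id : Fin 3 → Fin 3) i = t} F) i)))))).Coinvariants := finiteDimensional_jacquet_principalSeries _ (isOpen_ker_tch_three _ _ _ ha ha1 ha2)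
  have h_ob := nonempty_equiv_range ΦD hΦD
  obtain ⟨e⟩ := h_ob
  have hadd := fun ζ => finrank_weightSpace_eq_add_subrepresentation (Representation.parabolicIndGL F (id : Fin 3 → Fin 3) ((Representation.trivial ℂ (Π t : Fin 3, GL {i : Fin 3 // (id : Fin 3 → Fin 3) i = t} F) ℂ).twist (∏ i : Fin 3, ((![a, a * ((unramifiedTwist F 1 : QuasiChar F).toMonoidHom), a * ((unramifiedTwist F 1 : QuasiChar F).toMonoidHom) * ((unramifiedTwist F 1 : QuasiChar F).toMonoidHom)] : Fin 3 → (Fˣ →* ℂˣ)) i).comp (Matrix.GeneralLinearGroup.det.comp (Pi.evalMonoidHom (fun t : Fin 3 => GL {i : Fin 3 // (id : Fin 3 → Fin 3) i = t} F) i))))) hIs ΦD.range ζ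
  have hN := fun ζ : (Π t : Fin 3, GL {i : Fin 3 // (id : Fin 3 → Fin 3) i = t} F) → ℂ => finrank_weightSpace_eq_of_equiv _ _ e ζ
  have h_ob := table_D a hD
  obtain ⟨hD1, hD3, hD3p, hD0⟩ := h_ob
  -- the table of `I C₁` at the six orderings (★ REG via ★ C2b-wt)
  have hI := fun (σ : Equiv.Perm (Fin 3)) (θ' : Fin 3 → (Fˣ →* ℂˣ)) (hθ' : ∀ i, θ' i = (![a, a * ((unramifiedTwist F 1 : QuasiChar F).toMonoidHom), a * ((unramifiedTwist F 1 : QuasiChar F).toMonoidHom) * ((unramifiedTwist F 1 : QuasiChar F).toMonoidHom)] : Fin 3 → (Fˣ →* ℂˣ)) (σ.symm i)) =>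
    finrank_weightSpace_I_three_perm_eq_one _ _ _ ha ha1 ha2 (injective_cube_orderings a).1 σ θ' hθ'
  have e1 := hadd ζ; have e2 := hN ζ
  by_cases hζ1 : ζ = (fun m : (Π t : Fin 3, GL {i : Fin 3 // (id : Fin 3 → Fin 3) i = t} F) => ((((∏ i : Fin 3, ((![a, a * ((unramifiedTwist F 1 : QuasiChar F).toMonoidHom), a * ((unramifiedTwist F 1 : QuasiChar F).toMonoidHom) * ((unramifiedTwist F 1 : QuasiChar F).toMonoidHom)] : Fin 3 → (Fˣ →* ℂˣ)) i).comp (Matrix.GeneralLinearGroup.det.comp (Pi.evalMonoidHom (fun t : Fin 3 => GL {i : Fin 3 // (id : Fin 3 → Fin 3) i = t} F) i)))) m : ℂˣ) : ℂ))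
  · subst hζ1
    have hI1 := hI 1 (![a, a * ((unramifiedTwist F 1 : QuasiChar F).toMonoidHom), a * ((unramifiedTwist F 1 : QuasiChar F).toMonoidHom) * ((unramifiedTwist F 1 : QuasiChar F).toMonoidHom)] : Fin 3 → (Fˣ →* ℂˣ)) (fun i => by fin_cases i <;> rfl)
    linarith only [e1, e2, hD1, hI1]
  · by_cases hζ3 : ζ = (fun m : (Π t : Fin 3, GL {i : Fin 3 // (id : Fin 3 → Fin 3) i = t} F) => ((((∏ i : Fin 3, ((![a, a * ((unramifiedTwist F 1 : QuasiChar F).toMonoidHom) * ((unramifiedTwist F 1 : QuasiChar F).toMonoidHom), a * ((unramifiedTwist F 1 : QuasiChar F).toMonoidHom)] : Fin 3 → (Fˣ →* ℂˣ)) i).comp (Matrix.GeneralLinearGroup.det.comp (Pi.evalMonoidHom (fun t : Fin 3 => GL {i : Fin 3 // (id : Fin 3 → Fin 3) i = t} F) i)))) m : ℂˣ) : ℂ))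
    · subst hζ3
      have hI3 := hI (Equiv.swap 1 2) (![a, a * ((unramifiedTwist F 1 : QuasiChar F).toMonoidHom) * ((unramifiedTwist F 1 : QuasiChar F).toMonoidHom), a * ((unramifiedTwist F 1 : QuasiChar F).toMonoidHom)] : Fin 3 → (Fˣ →* ℂˣ)) (fun i => by fin_cases i <;> rfl)
      linarith only [e1, e2, hD3, hI3]
    · by_cases hζ3p : ζ = (fun m : (Π t : Fin 3, GL {i : Fin 3 // (id : Fin 3 → Fin 3) i = t} F) => ((((∏ i : Fin 3, ((![a * ((unramifiedTwist F 1 : QuasiChar F).toMonoidHom) * ((unramifiedTwist F 1 : QuasiChar F).toMonoidHom), a, a * ((unramifiedTwist F 1 : QuasiChar F).toMonoidHom)] : Fin 3 → (Fˣ →* ℂˣ)) i).comp (Matrix.GeneralLinearGroup.det.comp (Pi.evalMonoidHom (fun t : Fin 3 => GL {i : Fin 3 // (id : Fin 3 → Fin 3) i = t} F) i)))) m : ℂˣ) : ℂ))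
      · subst hζ3p
        have hI3p := hI (Equiv.swap 0 1 * Equiv.swap 1 2) (![a * ((unramifiedTwist F 1 : QuasiChar F).toMonoidHom) * ((unramifiedTwist F 1 : QuasiChar F).toMonoidHom), a, a * ((unramifiedTwist F 1 : QuasiChar F).toMonoidHom)] : Fin 3 → (Fˣ →* ℂˣ)) (fun i => by fin_cases i <;> rfl)
        linarith only [e1, e2, hD3p, hI3p]
      · have e3 := hD0 ζ hζ1 hζ3 hζ3p
        have e4 := finrank_weightSpace_I_three_eq_zero _ _ _ ha ha1 ha2 ζ (fun θ' hθ' => by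
          rcases hθ' with rfl | rfl | rfl | rfl | rfl | rfl
          · exact hζ1
          · exact hζ3
          · exact hζ4
          · exact hζ4p
          · exact hζ3p
          · exact hζ2)
        linarith only [e1, e2, e3, e4]

/-! ## §2 Two pieces whose weights add up to the class C₄ -/

include ha in
/-- **TWO PIECES**: for smooth `Z₁, Z₂` (f.d. `r_B`, constituents with `r_B ≠ 0`) whose weight tables ADD UP to `{{C₄ ↦ 1, C₄′ ↦ 1}}`, the rigidity `hS₁₂` puts the whole class C₄ into
one of them — irreducible by ★ C2b-gen (I2), trace `tr D′ − tr π₁` by ★ C2b′ — and leaves the other without weights, hence `0` with trace `0` (★ C2b-gen):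
`tr Z₁ + tr Z₂ = tr D′ − tr π₁`. [cite: Zelevinsky1980, Thm. 6.1, Cor. 7.5] [cite: BernsteinZelevinsky1977, §2.3, Thm. 2.9] -/
theorem smoothTrace_add_of_weights_add_C₄ [FiniteDimensional ℂ (Representation.restrictUnipotentGL F (id : Fin 3 → Fin 3) (Representation.parabolicIndGL F (![false, false, true] : Fin 3 → Bool) ((Representation.trivial ℂ (Π t : Bool, GL {i : Fin 3 // (![false, false, true] : Fin 3 → Bool) i = t} F) ℂ).twist ((a * ((unramifiedTwist F 1 : QuasiChar F).toMonoidHom) * ((unramifiedTwist F (1 / 2) : QuasiChar F).toMonoidHom)).comp ((Matrix.GeneralLinearGroup.det : GL {i : Fin 3 // (![false, false, true] : Fin 3 → Bool) i = false} F →* Fˣ).comp (Pi.evalMonoidHom (fun t : Bool => GL {i : Fin 3 // (![false, false, true] : Fin 3 → Bool) i = t} F) false)) * (a).comp ((Matrix.GeneralLinearGroup.det : GL {i : Fin 3 // (![false, false, true] : Fin 3 → Bool) i = true} F →* Fˣ).comp (Pi.evalMonoidHom (fun t : Bool => GL {i : Fin 3 // (![false, false, true] : Fin 3 → Bool) i =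 t} F) true)))))).Coinvariants]
    (hD' : ∀ ζ : (Π t : Fin 3, GL {i : Fin 3 // (id : Fin 3 → Fin 3) i = t} F) → ℂ, finrank ℂ ↥(⨅ m, Module.End.maxGenEigenspace (Representation.normalizedJacquetGL F (id : Fin 3 → Fin 3) (Representation.parabolicIndGL F (![false, false, true] : Fin 3 → Bool) ((Representation.trivial ℂ (Π t : Bool, GL {i : Fin 3 // (![false, false, true] : Fin 3 → Bool) i = t} F) ℂ).twist ((a * ((unramifiedTwist F 1 : QuasiChar F).toMonoidHom) * ((unramifiedTwist F (1 / 2) : QuasiChar F).toMonoidHom)).comp ((Matrix.GeneralLinearGroup.det : GL {i : Fin 3 // (![false, false, true] : Fin 3 → Bool) i = false} F →* Fˣ).comp (Pi.evalMonoidHom (fun t : Bool => GL {i : Fin 3 // (![false, false, true] : Fin 3 → Bool) i = t} F) false)) * (a).comp ((Matrix.GeneralLinearGroup.det : GL {i : Fin 3 // (![false, false, true] : Fin 3 → Bool) i = true} F →* Fˣ).comp (Pi.evalMonoidHom (fun t : Bool => GL {i : Fin 3 // (![false, false, true] : Fin 3 → Bool) i = t} F) true))))) m) (ζ m)) =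
      (if ζ = (fun m : (Π t : Fin 3, GL {i : Fin 3 // (id : Fin 3 → Fin 3) i = t} F) => ((((∏ i : Fin 3, ((![a * ((unramifiedTwist F 1 : QuasiChar F).toMonoidHom), a * ((unramifiedTwist F 1 : QuasiChar F).toMonoidHom) * ((unramifiedTwist F 1 : QuasiChar F).toMonoidHom), a] : Fin 3 → (Fˣ →* ℂˣ)) i).comp (Matrix.GeneralLinearGroup.det.comp (Pi.evalMonoidHom (fun t : Fin 3 => GL {i : Fin 3 // (id : Fin 3 → Fin 3) i = t} F) i)))) m : ℂˣ) : ℂ)) then 1 else 0) + (if ζ = (fun m : (Π t : Fin 3, GL {i : Fin 3 // (id : Fin 3 → Fin 3) i = t} F) => ((((∏ i : Fin 3, ((![a * ((unramifiedTwist F 1 : QuasiChar F).toMonoidHom), a, a * ((unramifiedTwist F 1 : QuasiChar F).toMonoidHom) * ((unramifiedTwist F 1 : QuasiChar F).toMonoidHom)] : Fin 3 → (Fˣ →* ℂˣ)) i).comp (Matrix.GeneralLinearGroup.det.comp (Pi.evalMonoidHom (fun t : Fin 3 => GL {i : Fin 3 // (id : Fin 3 → Fin 3) i = t} F) i)))) m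 : ℂˣ) : ℂ)) then 1 else 0) + (if ζ = (fun m : (Π t : Fin 3, GL {i : Fin 3 // (id : Fin 3 → Fin 3) i = t} F) => ((((∏ i : Fin 3, ((![a, a * ((unramifiedTwist F 1 : QuasiChar F).toMonoidHom), a * ((unramifiedTwist F 1 : QuasiChar F).toMonoidHom) * ((unramifiedTwist F 1 : QuasiChar F).toMonoidHom)] : Fin 3 → (Fˣ →* ℂˣ)) i).comp (Matrix.GeneralLinearGroup.det.comp (Pi.evalMonoidHom (fun t : Fin 3 => GL {i : Fin 3 // (id : Fin 3 → Fin 3) i = t} F) i)))) m : ℂˣ) : ℂ)) then 1 else 0))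
    (hS₁₂ : ∀ {Y : Type} [AddCommGroup Y] [Module ℂ Y] (V : Representation ℂ (GL (Fin 3) F) Y), V.IsSmooth → ∀ [FiniteDimensional ℂ (Representation.restrictUnipotentGL F (id : Fin 3 → Fin 3) V).Coinvariants],
      finrank ℂ ↥(⨅ m, Module.End.maxGenEigenspace (Representation.normalizedJacquetGL F (id : Fin 3 → Fin 3) V m) (((((∏ i : Fin 3, ((![a * ((unramifiedTwist F 1 : QuasiChar F).toMonoidHom), a, a * ((unramifiedTwist F 1 : QuasiChar F).toMonoidHom) * ((unramifiedTwist F 1 : QuasiChar F).toMonoidHom)] : Fin 3 → (Fˣ →* ℂˣ)) i).comp (Matrix.GeneralLinearGroup.det.comp (Pi.evalMonoidHom (fun t : Fin 3 => GL {i : Fin 3 // (id : Fin 3 → Fin 3) i = t} F) i)))) m : ℂˣ) : ℂ))) =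
        finrank ℂ ↥(⨅ m, Module.End.maxGenEigenspace (Representation.normalizedJacquetGL F (id : Fin 3 → Fin 3) V m) (((((∏ i : Fin 3, ((![a * ((unramifiedTwist F 1 : QuasiChar F).toMonoidHom), a * ((unramifiedTwist F 1 : QuasiChar F).toMonoidHom) * ((unramifiedTwist F 1 : QuasiChar F).toMonoidHom), a] : Fin 3 → (Fˣ →* ℂˣ)) i).comp (Matrix.GeneralLinearGroup.det.comp (Pi.evalMonoidHom (fun t : Fin 3 => GL {i : Fin 3 // (id : Fin 3 → Fin 3) i = t} F) i)))) m : ℂˣ) : ℂ))))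
    (hJ₄' : (∀ r : SmoothIrrep (GL (Fin 3) F), (IrrClass.mk r).IsConstituentOf (Representation.parabolicIndGL F (id : Fin 3 → Fin 3) ((Representation.trivial ℂ (Π t : Fin 3, GL {i : Fin 3 // (id : Fin 3 → Fin 3) i = t} F) ℂ).twist (∏ i : Fin 3, ((![a * ((unramifiedTwist F 1 : QuasiChar F).toMonoidHom), a * ((unramifiedTwist F 1 : QuasiChar F).toMonoidHom) * ((unramifiedTwist F 1 : QuasiChar F).toMonoidHom), a] : Fin 3 → (Fˣ →* ℂˣ)) i).comp (Matrix.GeneralLinearGroup.det.comp (Pi.evalMonoidHom (fun t : Fin 3 => GL {i : Fin 3 // (id : Fin 3 → Fin 3) i = t} F) i))))) → Nontrivial (Representation.restrictUnipotentGL F (id : Fin 3 → Fin 3) r.ρ).Coinvariants)) {Y₁ Y₂ : Type} [AddCommGroup Y₁] [Module ℂ Y₁] [AddCommGroup Y₂] [Module ℂ Y₂] (Z₁ : Representation ℂ (GL (Fin 3) F) Y₁) (Z₂ : Representation ℂ (GL (Fin 3) F) Y₂)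
    (hZ₁ : Z₁.IsSmooth) (hZ₂ : Z₂.IsSmooth) [FiniteDimensional ℂ (Representation.restrictUnipotentGL F (id : Fin 3 → Fin 3) Z₁).Coinvariants] [FiniteDimensional ℂ (Representation.restrictUnipotentGL F (id : Fin 3 → Fin 3) Z₂).Coinvariants]
    (hJZ₁ : (∀ r : SmoothIrrep (GL (Fin 3) F), (IrrClass.mk r).IsConstituentOf Z₁ → Nontrivial (Representation.restrictUnipotentGL F (id : Fin 3 → Fin 3) r.ρ).Coinvariants))
    (hJZ₂ : (∀ r : SmoothIrrep (GL (Fin 3) F), (IrrClass.mk r).IsConstituentOf Z₂ → Nontrivial (Representation.restrictUnipotentGL F (id : Fin 3 → Fin 3) r.ρ).Coinvariants))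
    (h4 : finrank ℂ ↥(⨅ m, Module.End.maxGenEigenspace (Representation.normalizedJacquetGL F (id : Fin 3 → Fin 3) Z₁ m) (((((∏ i : Fin 3, ((![a * ((unramifiedTwist F 1 : QuasiChar F).toMonoidHom), a, a * ((unramifiedTwist F 1 : QuasiChar F).toMonoidHom) * ((unramifiedTwist F 1 : QuasiChar F).toMonoidHom)] : Fin 3 → (Fˣ →* ℂˣ)) i).comp (Matrix.GeneralLinearGroup.det.comp (Pi.evalMonoidHom (fun t : Fin 3 => GL {i : Fin 3 // (id : Fin 3 → Fin 3) i = t} F) i)))) m : ℂˣ) : ℂ))) +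
      finrank ℂ ↥(⨅ m, Module.End.maxGenEigenspace (Representation.normalizedJacquetGL F (id : Fin 3 → Fin 3) Z₂ m) (((((∏ i : Fin 3, ((![a * ((unramifiedTwist F 1 : QuasiChar F).toMonoidHom), a, a * ((unramifiedTwist F 1 : QuasiChar F).toMonoidHom) * ((unramifiedTwist F 1 : QuasiChar F).toMonoidHom)] : Fin 3 → (Fˣ →* ℂˣ)) i).comp (Matrix.GeneralLinearGroup.det.comp (Pi.evalMonoidHom (fun t : Fin 3 => GL {i : Fin 3 // (id : Fin 3 → Fin 3) i = t} F) i)))) m : ℂˣ) : ℂ))) = 1)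
    (h4p : finrank ℂ ↥(⨅ m, Module.End.maxGenEigenspace (Representation.normalizedJacquetGL F (id : Fin 3 → Fin 3) Z₁ m) (((((∏ i : Fin 3, ((![a * ((unramifiedTwist F 1 : QuasiChar F).toMonoidHom), a * ((unramifiedTwist F 1 : QuasiChar F).toMonoidHom) * ((unramifiedTwist F 1 : QuasiChar F).toMonoidHom), a] : Fin 3 → (Fˣ →* ℂˣ)) i).comp (Matrix.GeneralLinearGroup.det.comp (Pi.evalMonoidHom (fun t : Fin 3 => GL {i : Fin 3 // (id : Fin 3 → Fin 3) i = t} F) i)))) m : ℂˣ) : ℂ))) +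
      finrank ℂ ↥(⨅ m, Module.End.maxGenEigenspace (Representation.normalizedJacquetGL F (id : Fin 3 → Fin 3) Z₂ m) (((((∏ i : Fin 3, ((![a * ((unramifiedTwist F 1 : QuasiChar F).toMonoidHom), a * ((unramifiedTwist F 1 : QuasiChar F).toMonoidHom) * ((unramifiedTwist F 1 : QuasiChar F).toMonoidHom), a] : Fin 3 → (Fˣ →* ℂˣ)) i).comp (Matrix.GeneralLinearGroup.det.comp (Pi.evalMonoidHom (fun t : Fin 3 => GL {i : Fin 3 // (id : Fin 3 → Fin 3) i = t} F) i)))) m : ℂˣ) : ℂ))) = 1)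
    (h0 : ∀ ζ : (Π t : Fin 3, GL {i : Fin 3 // (id : Fin 3 → Fin 3) i = t} F) → ℂ, ζ ≠ (fun m : (Π t : Fin 3, GL {i : Fin 3 // (id : Fin 3 → Fin 3) i = t} F) => ((((∏ i : Fin 3, ((![a * ((unramifiedTwist F 1 : QuasiChar F).toMonoidHom), a, a * ((unramifiedTwist F 1 : QuasiChar F).toMonoidHom) * ((unramifiedTwist F 1 : QuasiChar F).toMonoidHom)] : Fin 3 → (Fˣ →* ℂˣ)) i).comp (Matrix.GeneralLinearGroup.det.comp (Pi.evalMonoidHom (fun t : Fin 3 => GL {i : Fin 3 // (id : Fin 3 → Fin 3) i = t} F) i)))) m : ℂˣ) : ℂ)) → ζ ≠ (fun m : (Π t : Fin 3, GL {i : Fin 3 // (id : Fin 3 → Fin 3) i = t} F) => ((((∏ i : Fin 3, ((![a * ((unramifiedTwist F 1 : QuasiChar F).toMonoidHom), a * ((unramifiedTwist F 1 : QuasiChar F).toMonoidHom) * ((unramifiedTwist F 1 : QuasiChar F).toMonoidHom), a] : Fin 3 → (Fˣ →* ℂˣ)) i).comp (Matrix.GeneralLinearGroup.det.comp (Pi.evalMonoidHom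 (fun t : Fin 3 => GL {i : Fin 3 // (id : Fin 3 → Fin 3) i = t} F) i)))) m : ℂˣ) : ℂ)) →
      finrank ℂ ↥(⨅ m, Module.End.maxGenEigenspace (Representation.normalizedJacquetGL F (id : Fin 3 → Fin 3) Z₁ m) (ζ m)) = 0 ∧
      finrank ℂ ↥(⨅ m, Module.End.maxGenEigenspace (Representation.normalizedJacquetGL F (id : Fin 3 → Fin 3) Z₂ m) (ζ m)) = 0)
    [MeasurableSpace (GL (Fin 3) F)] [BorelSpace (GL (Fin 3) F)] (μ : Measure (GL (Fin 3) F)) [IsFiniteMeasureOnCompacts μ] (f : GL (Fin 3) F → ℂ) :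
    Z₁.smoothTrace μ f + Z₂.smoothTrace μ f = (Representation.parabolicIndGL F (![false, false, true] : Fin 3 → Bool) ((Representation.trivial ℂ (Π t : Bool, GL {i : Fin 3 // (![false, false, true] : Fin 3 → Bool) i = t} F) ℂ).twist ((a * ((unramifiedTwist F 1 : QuasiChar F).toMonoidHom) * ((unramifiedTwist F (1 / 2) : QuasiChar F).toMonoidHom)).comp ((Matrix.GeneralLinearGroup.det : GL {i : Fin 3 // (![false, false, true] : Fin 3 → Bool) i = false} F →* Fˣ).comp (Pi.evalMonoidHom (fun t : Bool => GL {i : Fin 3 // (![false, false, true] : Fin 3 → Bool) i = t} F) false)) * (a).comp ((Matrix.GeneralLinearGroup.det : GL {i : Fin 3 // (![false, false, true] : Fin 3 → Bool) i = true} F →* Fˣ).comp (Pi.evalMonoidHom (fun t : Bool => GL {i : Fin 3 // (![false, false, true] : Fin 3 → Bool) i = t} F) true))))).smoothTrace μ f - ((Representation.trivial ℂ (GL (Fin 3) F) ℂ).twist ((a * ((unramifiedTwist F 1 : QuasiChar F).toMonoidHom)).comp (Matrix.GeneralLinearGroup.det : GL (Fin 3) F →* Fˣ))).smoothTrace μ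 f := by
  have hc₁ := hS₁₂ Z₁ hZ₁
  have hconst₁ : ∀ N : Subrepresentation Z₁, finrank ℂ ↥(⨅ m, Module.End.maxGenEigenspace (Representation.normalizedJacquetGL F (id : Fin 3 → Fin 3) N.toRepresentation m) (((((∏ i : Fin 3, ((![a * ((unramifiedTwist F 1 : QuasiChar F).toMonoidHom), a, a * ((unramifiedTwist F 1 : QuasiChar F).toMonoidHom) * ((unramifiedTwist F 1 : QuasiChar F).toMonoidHom)] : Fin 3 → (Fˣ →* ℂˣ)) i).comp (Matrix.GeneralLinearGroup.det.comp (Pi.evalMonoidHom (fun t : Fin 3 => GL {i : Fin 3 // (id : Fin 3 → Fin 3) i = t} F) i)))) m : ℂˣ) : ℂ))) =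
      finrank ℂ ↥(⨅ m, Module.End.maxGenEigenspace (Representation.normalizedJacquetGL F (id : Fin 3 → Fin 3) N.toRepresentation m) (((((∏ i : Fin 3, ((![a * ((unramifiedTwist F 1 : QuasiChar F).toMonoidHom), a * ((unramifiedTwist F 1 : QuasiChar F).toMonoidHom) * ((unramifiedTwist F 1 : QuasiChar F).toMonoidHom), a] : Fin 3 → (Fˣ →* ℂˣ)) i).comp (Matrix.GeneralLinearGroup.det.comp (Pi.evalMonoidHom (fun t : Fin 3 => GL {i : Fin 3 // (id : Fin 3 → Fin 3) i = t} F) i)))) m : ℂˣ) : ℂ))) := fun N => by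
    haveI := finiteDimensional_jacquet_subrepresentation Z₁ monotone_id hZ₁ N
    exact hS₁₂ N.toRepresentation (hZ₁.toRepresentation N)
  have hconst₂ : ∀ N : Subrepresentation Z₂, finrank ℂ ↥(⨅ m, Module.End.maxGenEigenspace (Representation.normalizedJacquetGL F (id : Fin 3 → Fin 3) N.toRepresentation m) (((((∏ i : Fin 3, ((![a * ((unramifiedTwist F 1 : QuasiChar F).toMonoidHom), a, a * ((unramifiedTwist F 1 : QuasiChar F).toMonoidHom) * ((unramifiedTwist F 1 : QuasiChar F).toMonoidHom)] : Fin 3 → (Fˣ →* ℂˣ)) i).comp (Matrix.GeneralLinearGroup.det.comp (Pi.evalMonoidHom (fun t : Fin 3 => GL {i : Fin 3 // (id : Fin 3 → Fin 3) i = t} F) i)))) m : ℂˣ) : ℂ))) =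
      finrank ℂ ↥(⨅ m, Module.End.maxGenEigenspace (Representation.normalizedJacquetGL F (id : Fin 3 → Fin 3) N.toRepresentation m) (((((∏ i : Fin 3, ((![a * ((unramifiedTwist F 1 : QuasiChar F).toMonoidHom), a * ((unramifiedTwist F 1 : QuasiChar F).toMonoidHom) * ((unramifiedTwist F 1 : QuasiChar F).toMonoidHom), a] : Fin 3 → (Fˣ →* ℂˣ)) i).comp (Matrix.GeneralLinearGroup.det.comp (Pi.evalMonoidHom (fun t : Fin 3 => GL {i : Fin 3 // (id : Fin 3 → Fin 3) i = t} F) i)))) m : ℂˣ) : ℂ))) := fun N => by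
    haveI := finiteDimensional_jacquet_subrepresentation Z₂ monotone_id hZ₂ N
    exact hS₁₂ N.toRepresentation (hZ₂.toRepresentation N)
  by_cases ht : finrank ℂ ↥(⨅ m, Module.End.maxGenEigenspace (Representation.normalizedJacquetGL F (id : Fin 3 → Fin 3) Z₁ m) (((((∏ i : Fin 3, ((![a * ((unramifiedTwist F 1 : QuasiChar F).toMonoidHom), a, a * ((unramifiedTwist F 1 : QuasiChar F).toMonoidHom) * ((unramifiedTwist F 1 : QuasiChar F).toMonoidHom)] : Fin 3 → (Fˣ →* ℂˣ)) i).comp (Matrix.GeneralLinearGroup.det.comp (Pi.evalMonoidHom (fun t : Fin 3 => GL {i : Fin 3 // (id : Fin 3 → Fin 3) i = t} F) i)))) m : ℂˣ) : ℂ))) = 0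
  · -- all of the class sits in `Z₂`; `Z₁ = 0`
    have ht' : finrank ℂ ↥(⨅ m, Module.End.maxGenEigenspace (Representation.normalizedJacquetGL F (id : Fin 3 → Fin 3) Z₁ m) (((((∏ i : Fin 3, ((![a * ((unramifiedTwist F 1 : QuasiChar F).toMonoidHom), a * ((unramifiedTwist F 1 : QuasiChar F).toMonoidHom) * ((unramifiedTwist F 1 : QuasiChar F).toMonoidHom), a] : Fin 3 → (Fˣ →* ℂˣ)) i).comp (Matrix.GeneralLinearGroup.det.comp (Pi.evalMonoidHom (fun t : Fin 3 => GL {i : Fin 3 // (id : Fin 3 → Fin 3) i = t} F) i)))) m : ℂˣ) : ℂ))) = 0 := by rw [← hc₁]; exact ht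
    haveI : Subsingleton Y₁ := subsingleton_of_forall_finrank_weightSpace_eq_zero Z₁ hZ₁ hJZ₁ fun ζ => by
      by_cases hζ4 : ζ = (fun m : (Π t : Fin 3, GL {i : Fin 3 // (id : Fin 3 → Fin 3) i = t} F) => ((((∏ i : Fin 3, ((![a * ((unramifiedTwist F 1 : QuasiChar F).toMonoidHom), a, a * ((unramifiedTwist F 1 : QuasiChar F).toMonoidHom) * ((unramifiedTwist F 1 : QuasiChar F).toMonoidHom)] : Fin 3 → (Fˣ →* ℂˣ)) i).comp (Matrix.GeneralLinearGroup.det.comp (Pi.evalMonoidHom (fun t : Fin 3 => GL {i : Fin 3 // (id : Fin 3 → Fin 3) i = t} F) i)))) m : ℂˣ) : ℂ))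
      · rw [hζ4]; exact ht
      · by_cases hζ4p : ζ = (fun m : (Π t : Fin 3, GL {i : Fin 3 // (id : Fin 3 → Fin 3) i = t} F) => ((((∏ i : Fin 3, ((![a * ((unramifiedTwist F 1 : QuasiChar F).toMonoidHom), a * ((unramifiedTwist F 1 : QuasiChar F).toMonoidHom) * ((unramifiedTwist F 1 : QuasiChar F).toMonoidHom), a] : Fin 3 → (Fˣ →* ℂˣ)) i).comp (Matrix.GeneralLinearGroup.det.comp (Pi.evalMonoidHom (fun t : Fin 3 => GL {i : Fin 3 // (id : Fin 3 → Fin 3) i = t} F) i)))) m : ℂˣ) : ℂ))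
        · rw [hζ4p]; exact ht'
        · exact (h0 ζ hζ4 hζ4p).1
    have h24 : finrank ℂ ↥(⨅ m, Module.End.maxGenEigenspace (Representation.normalizedJacquetGL F (id : Fin 3 → Fin 3) Z₂ m) (((((∏ i : Fin 3, ((![a * ((unramifiedTwist F 1 : QuasiChar F).toMonoidHom), a, a * ((unramifiedTwist F 1 : QuasiChar F).toMonoidHom) * ((unramifiedTwist F 1 : QuasiChar F).toMonoidHom)] : Fin 3 → (Fˣ →* ℂˣ)) i).comp (Matrix.GeneralLinearGroup.det.comp (Pi.evalMonoidHom (fun t : Fin 3 => GL {i : Fin 3 // (id : Fin 3 → Fin 3) i = t} F) i)))) m : ℂˣ) : ℂ))) = 1 := by linarith only [h4, ht]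
    have h24p : finrank ℂ ↥(⨅ m, Module.End.maxGenEigenspace (Representation.normalizedJacquetGL F (id : Fin 3 → Fin 3) Z₂ m) (((((∏ i : Fin 3, ((![a * ((unramifiedTwist F 1 : QuasiChar F).toMonoidHom), a * ((unramifiedTwist F 1 : QuasiChar F).toMonoidHom) * ((unramifiedTwist F 1 : QuasiChar F).toMonoidHom), a] : Fin 3 → (Fˣ →* ℂˣ)) i).comp (Matrix.GeneralLinearGroup.det.comp (Pi.evalMonoidHom (fun t : Fin 3 => GL {i : Fin 3 // (id : Fin 3 → Fin 3) i = t} F) i)))) m : ℂˣ) : ℂ))) = 1 := by linarith only [h4p, ht']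
    haveI := nontrivial_of_finrank_weightSpace_ne_zero Z₂ _ (by rw [h24]; exact one_ne_zero)
    haveI : Z₂.IsIrreducible := isIrreducible_of_pair Z₂ hZ₂ hJZ₂ (fun m : (Π t : Fin 3, GL {i : Fin 3 // (id : Fin 3 → Fin 3) i = t} F) => ((((∏ i : Fin 3, ((![a * ((unramifiedTwist F 1 : QuasiChar F).toMonoidHom), a, a * ((unramifiedTwist F 1 : QuasiChar F).toMonoidHom) * ((unramifiedTwist F 1 : QuasiChar F).toMonoidHom)] : Fin 3 → (Fˣ →* ℂˣ)) i).comp (Matrix.GeneralLinearGroup.det.comp (Pi.evalMonoidHom (fun t : Fin 3 => GL {i : Fin 3 // (id : Fin 3 → Fin 3) i = t} F) i)))) m : ℂˣ) : ℂ)) (fun m : (Π t : Fin 3, GL {i : Fin 3 // (id : Fin 3 → Fin 3) i = t} F) => ((((∏ i : Fin 3, ((![a * ((unramifiedTwist F 1 : QuasiChar F).toMonoidHom), a * ((unramifiedTwist F 1 : QuasiChar F).toMonoidHom) * ((unramifiedTwist F 1 : QuasiChar F).toMonoidHom), a] : Fin 3 → (Fˣ →* ℂˣ)) i).comp (Matrix.GeneralLinearGroup.det.comp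 (Pi.evalMonoidHom (fun t : Fin 3 => GL {i : Fin 3 // (id : Fin 3 → Fin 3) i = t} F) i)))) m : ℂˣ) : ℂ)) h24.le h24p.le (fun ζ h h' => (h0 ζ h h').2) hconst₂
    rw [smoothTrace_eq_zero_of_subsingleton Z₁ μ f, zero_add]
    exact smoothTrace_of_weight_C₄ a ha hD' hS₁₂ hJ₄' Z₂ hZ₂ (Or.inl (by rw [h24]; exact one_ne_zero)) μ f
  · -- all of the class sits in `Z₁`; `Z₂ = 0`
    have h14 : finrank ℂ ↥(⨅ m, Module.End.maxGenEigenspace (Representation.normalizedJacquetGL F (id : Fin 3 → Fin 3) Z₁ m) (((((∏ i : Fin 3, ((![a * ((unramifiedTwist F 1 : QuasiChar F).toMonoidHom), a, a * ((unramifiedTwist F 1 : QuasiChar F).toMonoidHom) * ((unramifiedTwist F 1 : QuasiChar F).toMonoidHom)] : Fin 3 → (Fˣ →* ℂˣ)) i).comp (Matrix.GeneralLinearGroup.det.comp (Pi.evalMonoidHom (fun t : Fin 3 => GL {i : Fin 3 // (id : Fin 3 → Fin 3) i = t} F) i)))) m : ℂˣ) : ℂ))) = 1 := by have := Nat.pos_of_ne_zero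 ht; linarith only [h4, this]
    have h14p : finrank ℂ ↥(⨅ m, Module.End.maxGenEigenspace (Representation.normalizedJacquetGL F (id : Fin 3 → Fin 3) Z₁ m) (((((∏ i : Fin 3, ((![a * ((unramifiedTwist F 1 : QuasiChar F).toMonoidHom), a * ((unramifiedTwist F 1 : QuasiChar F).toMonoidHom) * ((unramifiedTwist F 1 : QuasiChar F).toMonoidHom), a] : Fin 3 → (Fˣ →* ℂˣ)) i).comp (Matrix.GeneralLinearGroup.det.comp (Pi.evalMonoidHom (fun t : Fin 3 => GL {i : Fin 3 // (id : Fin 3 → Fin 3) i = t} F) i)))) m : ℂˣ) : ℂ))) = 1 := by rw [← hc₁]; exact h14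
    have h24 : finrank ℂ ↥(⨅ m, Module.End.maxGenEigenspace (Representation.normalizedJacquetGL F (id : Fin 3 → Fin 3) Z₂ m) (((((∏ i : Fin 3, ((![a * ((unramifiedTwist F 1 : QuasiChar F).toMonoidHom), a, a * ((unramifiedTwist F 1 : QuasiChar F).toMonoidHom) * ((unramifiedTwist F 1 : QuasiChar F).toMonoidHom)] : Fin 3 → (Fˣ →* ℂˣ)) i).comp (Matrix.GeneralLinearGroup.det.comp (Pi.evalMonoidHom (fun t : Fin 3 => GL {i : Fin 3 // (id : Fin 3 → Fin 3) i = t} F) i)))) m : ℂˣ) : ℂ))) = 0 := by linarith only [h4, h14]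
    have h24p : finrank ℂ ↥(⨅ m, Module.End.maxGenEigenspace (Representation.normalizedJacquetGL F (id : Fin 3 → Fin 3) Z₂ m) (((((∏ i : Fin 3, ((![a * ((unramifiedTwist F 1 : QuasiChar F).toMonoidHom), a * ((unramifiedTwist F 1 : QuasiChar F).toMonoidHom) * ((unramifiedTwist F 1 : QuasiChar F).toMonoidHom), a] : Fin 3 → (Fˣ →* ℂˣ)) i).comp (Matrix.GeneralLinearGroup.det.comp (Pi.evalMonoidHom (fun t : Fin 3 => GL {i : Fin 3 // (id : Fin 3 → Fin 3) i = t} F) i)))) m : ℂˣ) : ℂ))) = 0 := by linarith only [h4p, h14p]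
    haveI : Subsingleton Y₂ := subsingleton_of_forall_finrank_weightSpace_eq_zero Z₂ hZ₂ hJZ₂ fun ζ => by
      by_cases hζ4 : ζ = (fun m : (Π t : Fin 3, GL {i : Fin 3 // (id : Fin 3 → Fin 3) i = t} F) => ((((∏ i : Fin 3, ((![a * ((unramifiedTwist F 1 : QuasiChar F).toMonoidHom), a, a * ((unramifiedTwist F 1 : QuasiChar F).toMonoidHom) * ((unramifiedTwist F 1 : QuasiChar F).toMonoidHom)] : Fin 3 → (Fˣ →* ℂˣ)) i).comp (Matrix.GeneralLinearGroup.det.comp (Pi.evalMonoidHom (fun t : Fin 3 => GL {i : Fin 3 // (id : Fin 3 → Fin 3) i = t} F) i)))) m : ℂˣ) : ℂ))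
      · rw [hζ4]; exact h24
      · by_cases hζ4p : ζ = (fun m : (Π t : Fin 3, GL {i : Fin 3 // (id : Fin 3 → Fin 3) i = t} F) => ((((∏ i : Fin 3, ((![a * ((unramifiedTwist F 1 : QuasiChar F).toMonoidHom), a * ((unramifiedTwist F 1 : QuasiChar F).toMonoidHom) * ((unramifiedTwist F 1 : QuasiChar F).toMonoidHom), a] : Fin 3 → (Fˣ →* ℂˣ)) i).comp (Matrix.GeneralLinearGroup.det.comp (Pi.evalMonoidHom (fun t : Fin 3 => GL {i : Fin 3 // (id : Fin 3 → Fin 3) i = t} F) i)))) m : ℂˣ) : ℂ))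
        · rw [hζ4p]; exact h24p
        · exact (h0 ζ hζ4 hζ4p).2
    haveI := nontrivial_of_finrank_weightSpace_ne_zero Z₁ _ (by rw [h14]; exact one_ne_zero)
    haveI : Z₁.IsIrreducible := isIrreducible_of_pair Z₁ hZ₁ hJZ₁ (fun m : (Π t : Fin 3, GL {i : Fin 3 // (id : Fin 3 → Fin 3) i = t} F) => ((((∏ i : Fin 3, ((![a * ((unramifiedTwist F 1 : QuasiChar F).toMonoidHom), a, a * ((unramifiedTwist F 1 : QuasiChar F).toMonoidHom) * ((unramifiedTwist F 1 : QuasiChar F).toMonoidHom)] : Fin 3 → (Fˣ →* ℂˣ)) i).comp (Matrix.GeneralLinearGroup.det.comp (Pi.evalMonoidHom (fun t : Fin 3 => GL {i : Fin 3 // (id : Fin 3 → Fin 3) i = t} F) i)))) m : ℂˣ) : ℂ)) (fun m : (Π t : Fin 3, GL {i : Fin 3 // (id : Fin 3 → Fin 3) i = t} F) => ((((∏ i : Fin 3, ((![a * ((unramifiedTwist F 1 : QuasiChar F).toMonoidHom), a * ((unramifiedTwist F 1 : QuasiChar F).toMonoidHom) * ((unramifiedTwist F 1 : QuasiChar F).toMonoidHom),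 a] : Fin 3 → (Fˣ →* ℂˣ)) i).comp (Matrix.GeneralLinearGroup.det.comp (Pi.evalMonoidHom (fun t : Fin 3 => GL {i : Fin 3 // (id : Fin 3 → Fin 3) i = t} F) i)))) m : ℂˣ) : ℂ)) h14.le h14p.le (fun ζ h h' => (h0 ζ h h').1) hconst₁
    rw [smoothTrace_eq_zero_of_subsingleton Z₂ μ f, add_zero]
    exact smoothTrace_of_weight_C₄ a ha hD' hS₁₂ hJ₄' Z₁ hZ₁ (Or.inl (by rw [h14]; exact one_ne_zero)) μ f

/-! ## §3 Class C₂: the subquotient `P ⁄ T ≅ W` of `V₂` and `tr W = tr I(C₁) − tr D − tr D′ + tr π₁` -/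

include ha in
/-- **SOCLE STEP**: for `Ψ : V₂ → I C₂` non-zero and an embedding `Φ_W : W ↪ I C₂` of an irreducible smooth `W` with `mult W (wt C₂) ≠ 0`, the image of `W` lies inside `range Ψ`
(`range Ψ ≠ 0` carries `wt C₂` by ★ EMB's converse; `mult (I C₂) (wt C₂) = 1` by ★ REG; ★ C2b-gen socle argument). [cite: BernsteinZelevinsky1977, Cor. 2.13, §2.3] [cite: Zelevinsky1980, §9] -/
theorem range_le_range_of_weight_C₂ (ΦD : (Representation.parabolicIndGL F (![false, false, true] : Fin 3 → Bool) ((Representation.trivial ℂ (Π t : Bool, GL {i : Fin 3 // (![false, false, true] : Fin 3 → Bool) i = t} F) ℂ).twist ((a * ((unramifiedTwist F (1 / 2) : QuasiChar F).toMonoidHom)).comp ((Matrix.GeneralLinearGroup.det : GL {i : Fin 3 // (![false, false, true] : Fin 3 → Bool) i = false} F →* Fˣ).comp (Pi.evalMonoidHom (fun t : Bool => GL {i : Fin 3 // (![false, false, true] : Fin 3 → Bool) i = t} F) false)) * (a * ((unramifiedTwist F 1 : QuasiChar F).toMonoidHom) * ((unramifiedTwist F 1 : QuasiChar F).toMonoidHom)).comp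 ((Matrix.GeneralLinearGroup.det : GL {i : Fin 3 // (![false, false, true] : Fin 3 → Bool) i = true} F →* Fˣ).comp (Pi.evalMonoidHom (fun t : Bool => GL {i : Fin 3 // (![false, false, true] : Fin 3 → Bool) i = t} F) true))))).IntertwiningMap (Representation.parabolicIndGL F (id : Fin 3 → Fin 3) ((Representation.trivial ℂ (Π t : Fin 3, GL {i : Fin 3 // (id : Fin 3 → Fin 3) i = t} F) ℂ).twist (∏ i : Fin 3, ((![a, a * ((unramifiedTwist F 1 : QuasiChar F).toMonoidHom), a * ((unramifiedTwist F 1 : QuasiChar F).toMonoidHom) * ((unramifiedTwist F 1 : QuasiChar F).toMonoidHom)] : Fin 3 → (Fˣ →* ℂˣ)) i).comp (Matrix.GeneralLinearGroup.det.comp (Pi.evalMonoidHom (fun t : Fin 3 => GL {i : Fin 3 // (id : Fin 3 → Fin 3) i = t} F) i))))))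
    {Y : Type} [AddCommGroup Y] [Module ℂ Y] (W : Representation ℂ (GL (Fin 3) F) Y) [W.IsIrreducible] [FiniteDimensional ℂ (Representation.restrictUnipotentGL F (id : Fin 3 → Fin 3) W).Coinvariants]
    (h : finrank ℂ ↥(⨅ m, Module.End.maxGenEigenspace (Representation.normalizedJacquetGL F (id : Fin 3 → Fin 3) W m) (((((∏ i : Fin 3, ((![a * ((unramifiedTwist F 1 : QuasiChar F).toMonoidHom) * ((unramifiedTwist F 1 : QuasiChar F).toMonoidHom), a * ((unramifiedTwist F 1 : QuasiChar F).toMonoidHom), a] : Fin 3 → (Fˣ →* ℂˣ)) i).comp (Matrix.GeneralLinearGroup.det.comp (Pi.evalMonoidHom (fun t : Fin 3 => GL {i : Fin 3 // (id : Fin 3 → Fin 3) i = t} F) i)))) m : ℂˣ) : ℂ))) ≠ 0)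
    (Ψ : (ΦD.range.quotientRep).IntertwiningMap (Representation.parabolicIndGL F (id : Fin 3 → Fin 3) ((Representation.trivial ℂ (Π t : Fin 3, GL {i : Fin 3 // (id : Fin 3 → Fin 3) i = t} F) ℂ).twist (∏ i : Fin 3, ((![a * ((unramifiedTwist F 1 : QuasiChar F).toMonoidHom) * ((unramifiedTwist F 1 : QuasiChar F).toMonoidHom), a * ((unramifiedTwist F 1 : QuasiChar F).toMonoidHom), a] : Fin 3 → (Fˣ →* ℂˣ)) i).comp (Matrix.GeneralLinearGroup.det.comp (Pi.evalMonoidHom (fun t : Fin 3 => GL {i : Fin 3 // (id : Fin 3 → Fin 3) i = t} F) i)))))) (hΨ : Ψ ≠ 0)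
    (ΦW : W.IntertwiningMap (Representation.parabolicIndGL F (id : Fin 3 → Fin 3) ((Representation.trivial ℂ (Π t : Fin 3, GL {i : Fin 3 // (id : Fin 3 → Fin 3) i = t} F) ℂ).twist (∏ i : Fin 3, ((![a * ((unramifiedTwist F 1 : QuasiChar F).toMonoidHom) * ((unramifiedTwist F 1 : QuasiChar F).toMonoidHom), a * ((unramifiedTwist F 1 : QuasiChar F).toMonoidHom), a] : Fin 3 → (Fˣ →* ℂˣ)) i).comp (Matrix.GeneralLinearGroup.det.comp (Pi.evalMonoidHom (fun t : Fin 3 => GL {i : Fin 3 // (id : Fin 3 → Fin 3) i = t} F) i)))))) (hΦW : Function.Injective ΦW) :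
    ΦW.range ≤ Ψ.range := by
  have h_ob := isOpen_ker_letters a ha
  obtain ⟨ha1, ha2⟩ := h_ob
  have hI₂s : (Representation.parabolicIndGL F (id : Fin 3 → Fin 3) ((Representation.trivial ℂ (Π t : Fin 3, GL {i : Fin 3 // (id : Fin 3 → Fin 3) i = t} F) ℂ).twist (∏ i : Fin 3, ((![a * ((unramifiedTwist F 1 : QuasiChar F).toMonoidHom) * ((unramifiedTwist F 1 : QuasiChar F).toMonoidHom), a * ((unramifiedTwist F 1 : QuasiChar F).toMonoidHom), a] : Fin 3 → (Fˣ →* ℂˣ)) i).comp (Matrix.GeneralLinearGroup.det.comp (Pi.evalMonoidHom (fun t : Fin 3 => GL {i : Fin 3 // (id : Fin 3 → Fin 3) i = t} F) i))))).IsSmooth := isSmooth_principalSeries _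
  haveI : FiniteDimensional ℂ (Representation.restrictUnipotentGL F (id : Fin 3 → Fin 3) (Representation.parabolicIndGL F (id : Fin 3 → Fin 3) ((Representation.trivial ℂ (Π t : Fin 3, GL {i : Fin 3 // (id : Fin 3 → Fin 3) i = t} F) ℂ).twist (∏ i : Fin 3, ((![a * ((unramifiedTwist F 1 : QuasiChar F).toMonoidHom) * ((unramifiedTwist F 1 : QuasiChar F).toMonoidHom), a * ((unramifiedTwist F 1 : QuasiChar F).toMonoidHom), a] : Fin 3 → (Fˣ →* ℂˣ)) i).comp (Matrix.GeneralLinearGroup.det.comp (Pi.evalMonoidHom (fun t : Fin 3 => GL {i : Fin 3 // (id : Fin 3 → Fin 3) i = t} F) i)))))).Coinvariants := finiteDimensional_jacquet_principalSeries _ (isOpen_ker_tch_three _ _ _ ha2 ha1 ha)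
  haveI := isIrreducible_range ΦW hΦW
  have h_ob := nonempty_equiv_range ΦW hΦW
  obtain ⟨eW⟩ := h_ob
  have hMs : Ψ.range.toRepresentation.IsSmooth := hI₂s.toRepresentation Ψ.range
  haveI := finiteDimensional_jacquet_subrepresentation (Representation.parabolicIndGL F (id : Fin 3 → Fin 3) ((Representation.trivial ℂ (Π t : Fin 3, GL {i : Fin 3 // (id : Fin 3 → Fin 3) i = t} F) ℂ).twist (∏ i : Fin 3, ((![a * ((unramifiedTwist F 1 : QuasiChar F).toMonoidHom) * ((unramifiedTwist F 1 : QuasiChar F).toMonoidHom), a * ((unramifiedTwist F 1 : QuasiChar F).toMonoidHom), a] : Fin 3 → (Fˣ →* ℂˣ)) i).comp (Matrix.GeneralLinearGroup.det.comp (Pi.evalMonoidHom (fun t : Fin 3 => GL {i : Fin 3 // (id : Fin 3 → Fin 3) i = t} F) i))))) monotone_id hI₂s Ψ.range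
  -- `range Ψ ≠ 0`, so the inclusion `range Ψ ↪ I C₂` is a non-zero intertwining map
  have hsub : Subrepresentation.subtypeIntertwiningMap Ψ.range ≠ 0 := by
    intro h0
    apply hΨ
    refine Representation.IntertwiningMap.ext (LinearMap.ext fun v => ?_)
    have hx := congrArg (fun g : Ψ.range.toRepresentation.IntertwiningMap (Representation.parabolicIndGL F (id : Fin 3 → Fin 3) ((Representation.trivial ℂ (Π t : Fin 3, GL {i : Fin 3 // (id : Fin 3 → Fin 3) i = t} F) ℂ).twist (∏ i : Fin 3, ((![a * ((unramifiedTwist F 1 : QuasiChar F).toMonoidHom) * ((unramifiedTwist F 1 : QuasiChar F).toMonoidHom), a * ((unramifiedTwist F 1 : QuasiChar F).toMonoidHom), a] : Fin 3 → (Fˣ →* ℂˣ)) i).comp (Matrix.GeneralLinearGroup.det.comp (Pi.evalMonoidHom (fun t : Fin 3 => GL {i : Fin 3 // (id : Fin 3 → Fin 3) i = t} F) i))))) => g ⟨Ψ v, v, rfl⟩) h0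
    simp only [Representation.IntertwiningMap.coe_zero, Pi.zero_apply] at hx
    rw [Representation.IntertwiningMap.zero_toLinearMap, LinearMap.zero_apply, Representation.IntertwiningMap.toLinearMap_apply]
    exact hx
  have hM2 := finrank_weightSpace_ne_zero_of_intertwiningMap_ne_zero Ψ.range.toRepresentation hMs (∏ i : Fin 3, ((![a * ((unramifiedTwist F 1 : QuasiChar F).toMonoidHom) * ((unramifiedTwist F 1 : QuasiChar F).toMonoidHom), a * ((unramifiedTwist F 1 : QuasiChar F).toMonoidHom), a] : Fin 3 → (Fˣ →* ℂˣ)) i).comp (Matrix.GeneralLinearGroup.det.comp (Pi.evalMonoidHom (fun t : Fin 3 => GL {i : Fin 3 // (id : Fin 3 → Fin 3) i = t} F) i))) (Subrepresentation.subtypeIntertwiningMap Ψ.range) hsub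
  refine le_of_isIrreducible_of_finrank_weightSpace_le_one (Representation.parabolicIndGL F (id : Fin 3 → Fin 3) ((Representation.trivial ℂ (Π t : Fin 3, GL {i : Fin 3 // (id : Fin 3 → Fin 3) i = t} F) ℂ).twist (∏ i : Fin 3, ((![a * ((unramifiedTwist F 1 : QuasiChar F).toMonoidHom) * ((unramifiedTwist F 1 : QuasiChar F).toMonoidHom), a * ((unramifiedTwist F 1 : QuasiChar F).toMonoidHom), a] : Fin 3 → (Fˣ →* ℂˣ)) i).comp (Matrix.GeneralLinearGroup.det.comp (Pi.evalMonoidHom (fun t : Fin 3 => GL {i : Fin 3 // (id : Fin 3 → Fin 3) i = t} F) i))))) hI₂s ΦW.range Ψ.range (fun m : (Π t : Fin 3, GL {i : Fin 3 // (id : Fin 3 → Fin 3) i = t} F) => ((((∏ i : Fin 3, ((![a * ((unramifiedTwist F 1 : QuasiChar F).toMonoidHom) * ((unramifiedTwist F 1 : QuasiChar F).toMonoidHom), a * ((unramifiedTwist F 1 : QuasiChar F).toMonoidHom), a] : Fin 3 → (Fˣ →* ℂˣ)) i).comp (Matrix.GeneralLinearGroup.det.comp (Pi.evalMonoidHom (fun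 t : Fin 3 => GL {i : Fin 3 // (id : Fin 3 → Fin 3) i = t} F) i)))) m : ℂˣ) : ℂ)) ?_ ?_ hM2
  · exact (finrank_weightSpace_I_three_perm_eq_one _ _ _ ha2 ha1 ha (injective_cube_orderings a).2.1 1 _ (fun i => rfl)).le
  · rw [← finrank_weightSpace_eq_of_equiv _ _ eW]; exact h

include ha in
/-- **`W` AS A SUBQUOTIENT OF `V₂ = I C₁ ⁄ D`**: for an irreducible smooth `W` with `mult W (wt C₂) ≠ 0` there are `P ≤ V₂` and `T ≤ P` with `P ⁄ T ≅ W` — `Ψ : V₂ → I C₂` non-zero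
(★ EMB), `W ↪ I C₂` inside `range Ψ` (socle step), `P := Ψ⁻¹(W)`, `T := ker (Ψ|_P)`, first isomorphism theorem (★ C2b-gen).
[cite: Zelevinsky1980, Thm. 6.1, §9] [cite: BernsteinZelevinsky1977, §2.3, Cor. 2.13] -/
theorem exists_subquotient_of_weight_C₂ [FiniteDimensional ℂ (Representation.restrictUnipotentGL F (id : Fin 3 → Fin 3) (Representation.parabolicIndGL F (![false, false, true] : Fin 3 → Bool) ((Representation.trivial ℂ (Π t : Bool, GL {i : Fin 3 // (![false, false, true] : Fin 3 → Bool) i = t} F) ℂ).twist ((a * ((unramifiedTwist F (1 / 2) : QuasiChar F).toMonoidHom)).comp ((Matrix.GeneralLinearGroup.det : GL {i : Fin 3 // (![false, false, true] : Fin 3 → Bool) i = false} F →* Fˣ).comp (Pi.evalMonoidHom (fun t : Bool => GL {i : Fin 3 // (![false, false, true] : Fin 3 → Bool) i = t} F) false)) * (a * ((unramifiedTwist F 1 : QuasiChar F).toMonoidHom) * ((unramifiedTwist F 1 : QuasiChar F).toMonoidHom)).comp ((Matrix.GeneralLinearGroup.det : GL {i : Fin 3 // (![false, false, true] : Fin 3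 → Bool) i = true} F →* Fˣ).comp (Pi.evalMonoidHom (fun t : Bool => GL {i : Fin 3 // (![false, false, true] : Fin 3 → Bool) i = t} F) true)))))).Coinvariants]
    (hD : ∀ ζ : (Π t : Fin 3, GL {i : Fin 3 // (id : Fin 3 → Fin 3) i = t} F) → ℂ, finrank ℂ ↥(⨅ m, Module.End.maxGenEigenspace (Representation.normalizedJacquetGL F (id : Fin 3 → Fin 3) (Representation.parabolicIndGL F (![false, false, true] : Fin 3 → Bool) ((Representation.trivial ℂ (Π t : Bool, GL {i : Fin 3 // (![false, false, true] : Fin 3 → Bool) i = t} F) ℂ).twist ((a * ((unramifiedTwist F (1 / 2) : QuasiChar F).toMonoidHom)).comp ((Matrix.GeneralLinearGroup.det : GL {i : Fin 3 // (![false, false, true] : Fin 3 → Bool) i = false} F →* Fˣ).comp (Pi.evalMonoidHom (fun t : Bool => GL {i : Fin 3 // (![false, false, true] : Fin 3 → Bool) i = t} F) false)) * (a * ((unramifiedTwist F 1 : QuasiChar F).toMonoidHom) * ((unramifiedTwist F 1 : QuasiChar F).toMonoidHom)).comp ((Matrix.GeneralLinearGroup.det : GL {i : Fin 3 // (![false,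 false, true] : Fin 3 → Bool) i = true} F →* Fˣ).comp (Pi.evalMonoidHom (fun t : Bool => GL {i : Fin 3 // (![false, false, true] : Fin 3 → Bool) i = t} F) true))))) m) (ζ m)) =
      (if ζ = (fun m : (Π t : Fin 3, GL {i : Fin 3 // (id : Fin 3 → Fin 3) i = t} F) => ((((∏ i : Fin 3, ((![a, a * ((unramifiedTwist F 1 : QuasiChar F).toMonoidHom), a * ((unramifiedTwist F 1 : QuasiChar F).toMonoidHom) * ((unramifiedTwist F 1 : QuasiChar F).toMonoidHom)] : Fin 3 → (Fˣ →* ℂˣ)) i).comp (Matrix.GeneralLinearGroup.det.comp (Pi.evalMonoidHom (fun t : Fin 3 => GL {i : Fin 3 // (id : Fin 3 → Fin 3) i = t} F) i)))) m : ℂˣ) : ℂ)) then 1 else 0) + (if ζ = (fun m : (Π t : Fin 3, GL {i : Fin 3 // (id : Fin 3 → Fin 3) i = t} F) => ((((∏ i : Fin 3, ((![a, a * ((unramifiedTwist F 1 : QuasiChar F).toMonoidHom) * ((unramifiedTwist F 1 : QuasiChar F).toMonoidHom), a * ((unramifiedTwist F 1 : QuasiChar F).toMonoidHom)] : Fin 3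 → (Fˣ →* ℂˣ)) i).comp (Matrix.GeneralLinearGroup.det.comp (Pi.evalMonoidHom (fun t : Fin 3 => GL {i : Fin 3 // (id : Fin 3 → Fin 3) i = t} F) i)))) m : ℂˣ) : ℂ)) then 1 else 0) + (if ζ = (fun m : (Π t : Fin 3, GL {i : Fin 3 // (id : Fin 3 → Fin 3) i = t} F) => ((((∏ i : Fin 3, ((![a * ((unramifiedTwist F 1 : QuasiChar F).toMonoidHom) * ((unramifiedTwist F 1 : QuasiChar F).toMonoidHom), a, a * ((unramifiedTwist F 1 : QuasiChar F).toMonoidHom)] : Fin 3 → (Fˣ →* ℂˣ)) i).comp (Matrix.GeneralLinearGroup.det.comp (Pi.evalMonoidHom (fun t : Fin 3 => GL {i : Fin 3 // (id : Fin 3 → Fin 3) i = t} F) i)))) m : ℂˣ) : ℂ)) then 1 else 0))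
    (ΦD : (Representation.parabolicIndGL F (![false, false, true] : Fin 3 → Bool) ((Representation.trivial ℂ (Π t : Bool, GL {i : Fin 3 // (![false, false, true] : Fin 3 → Bool) i = t} F) ℂ).twist ((a * ((unramifiedTwist F (1 / 2) : QuasiChar F).toMonoidHom)).comp ((Matrix.GeneralLinearGroup.det : GL {i : Fin 3 // (![false, false, true] : Fin 3 → Bool) i = false} F →* Fˣ).comp (Pi.evalMonoidHom (fun t : Bool => GL {i : Fin 3 // (![false, false, true] : Fin 3 → Bool) i = t} F) false)) * (a * ((unramifiedTwist F 1 : QuasiChar F).toMonoidHom) * ((unramifiedTwist F 1 : QuasiChar F).toMonoidHom)).comp ((Matrix.GeneralLinearGroup.det : GL {i : Fin 3 // (![false, false, true] : Fin 3 → Bool) i = true} F →* Fˣ).comp (Pi.evalMonoidHom (fun t : Bool => GL {i : Fin 3 // (![false, false, true] : Fin 3 → Bool) i = t} F) true))))).IntertwiningMap (Representation.parabolicIndGL F (id : Fin 3 → Fin 3) ((Representation.trivial ℂ (Π t : Fin 3, GL {i : Fin 3 // (id : Fin 3 → Fin 3) i = t} F) ℂ).twist (∏ i : Fin 3, ((![a,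 a * ((unramifiedTwist F 1 : QuasiChar F).toMonoidHom), a * ((unramifiedTwist F 1 : QuasiChar F).toMonoidHom) * ((unramifiedTwist F 1 : QuasiChar F).toMonoidHom)] : Fin 3 → (Fˣ →* ℂˣ)) i).comp (Matrix.GeneralLinearGroup.det.comp (Pi.evalMonoidHom (fun t : Fin 3 => GL {i : Fin 3 // (id : Fin 3 → Fin 3) i = t} F) i)))))) (hΦD : Function.Injective ΦD) {Y : Type} [AddCommGroup Y] [Module ℂ Y] (W : Representation ℂ (GL (Fin 3) F) Y) [W.IsIrreducible] (hW : W.IsSmooth)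
    [FiniteDimensional ℂ (Representation.restrictUnipotentGL F (id : Fin 3 → Fin 3) W).Coinvariants]
    (h : finrank ℂ ↥(⨅ m, Module.End.maxGenEigenspace (Representation.normalizedJacquetGL F (id : Fin 3 → Fin 3) W m) (((((∏ i : Fin 3, ((![a * ((unramifiedTwist F 1 : QuasiChar F).toMonoidHom) * ((unramifiedTwist F 1 : QuasiChar F).toMonoidHom), a * ((unramifiedTwist F 1 : QuasiChar F).toMonoidHom), a] : Fin 3 → (Fˣ →* ℂˣ)) i).comp (Matrix.GeneralLinearGroup.det.comp (Pi.evalMonoidHom (fun t : Fin 3 => GL {i : Fin 3 // (id : Fin 3 → Fin 3) i = t} F) i)))) m : ℂˣ) : ℂ))) ≠ 0) :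
    ∃ (P : Subrepresentation ΦD.range.quotientRep) (T : Subrepresentation P.toRepresentation), Nonempty (T.quotientRep.Equiv W) := by
  have h_ob := isOpen_ker_letters a ha
  obtain ⟨ha1, ha2⟩ := h_ob
  have hIs : (Representation.parabolicIndGL F (id : Fin 3 → Fin 3) ((Representation.trivial ℂ (Π t : Fin 3, GL {i : Fin 3 // (id : Fin 3 → Fin 3) i = t} F) ℂ).twist (∏ i : Fin 3, ((![a, a * ((unramifiedTwist F 1 : QuasiChar F).toMonoidHom), a * ((unramifiedTwist F 1 : QuasiChar F).toMonoidHom) * ((unramifiedTwist F 1 : QuasiChar F).toMonoidHom)] : Fin 3 → (Fˣ →* ℂˣ)) i).comp (Matrix.GeneralLinearGroup.det.comp (Pi.evalMonoidHom (fun t : Fin 3 => GL {i : Fin 3 // (id : Fin 3 → Fin 3) i = t} F) i))))).IsSmooth := isSmooth_principalSeries _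
  haveI : FiniteDimensional ℂ (Representation.restrictUnipotentGL F (id : Fin 3 → Fin 3) (Representation.parabolicIndGL F (id : Fin 3 → Fin 3) ((Representation.trivial ℂ (Π t : Fin 3, GL {i : Fin 3 // (id : Fin 3 → Fin 3) i = t} F) ℂ).twist (∏ i : Fin 3, ((![a, a * ((unramifiedTwist F 1 : QuasiChar F).toMonoidHom), a * ((unramifiedTwist F 1 : QuasiChar F).toMonoidHom) * ((unramifiedTwist F 1 : QuasiChar F).toMonoidHom)] : Fin 3 → (Fˣ →* ℂˣ)) i).comp (Matrix.GeneralLinearGroup.det.comp (Pi.evalMonoidHom (fun t : Fin 3 => GL {i : Fin 3 // (id : Fin 3 → Fin 3) i = t} F) i)))))).Coinvariants := finiteDimensional_jacquet_principalSeries _ (isOpen_ker_tch_three _ _ _ ha ha1 ha2)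
  have hV₂s : ΦD.range.quotientRep.IsSmooth := hIs.of_surjective ΦD.range.mkQ ΦD.range.mkQ_surjective
  haveI := finiteDimensional_jacquet_quotientRep (c := (id : Fin 3 → Fin 3)) (Representation.parabolicIndGL F (id : Fin 3 → Fin 3) ((Representation.trivial ℂ (Π t : Fin 3, GL {i : Fin 3 // (id : Fin 3 → Fin 3) i = t} F) ℂ).twist (∏ i : Fin 3, ((![a, a * ((unramifiedTwist F 1 : QuasiChar F).toMonoidHom), a * ((unramifiedTwist F 1 : QuasiChar F).toMonoidHom) * ((unramifiedTwist F 1 : QuasiChar F).toMonoidHom)] : Fin 3 → (Fˣ →* ℂˣ)) i).comp (Matrix.GeneralLinearGroup.det.comp (Pi.evalMonoidHom (fun t : Fin 3 => GL {i : Fin 3 // (id : Fin 3 → Fin 3) i = t} F) i))))) ΦD.range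
  have h_ob := weights_quotient_I_D_pos a ha hD ΦD hΦD
  obtain ⟨v2, -, -⟩ := h_ob
  haveI : FiniteDimensional ℂ (Representation.restrictUnipotentGL F (id : Fin 3 → Fin 3) (Representation.parabolicIndGL F (id : Fin 3 → Fin 3) ((Representation.trivial ℂ (Π t : Fin 3, GL {i : Fin 3 // (id : Fin 3 → Fin 3) i = t} F) ℂ).twist (∏ i : Fin 3, ((![a * ((unramifiedTwist F 1 : QuasiChar F).toMonoidHom) * ((unramifiedTwist F 1 : QuasiChar F).toMonoidHom), a * ((unramifiedTwist F 1 : QuasiChar F).toMonoidHom), a] : Fin 3 → (Fˣ →* ℂˣ)) i).comp (Matrix.GeneralLinearGroup.det.comp (Pi.evalMonoidHom (fun t : Fin 3 => GL {i : Fin 3 // (id : Fin 3 → Fin 3) i = t} F) i)))))).Coinvariants := finiteDimensional_jacquet_principalSeries _ (isOpen_ker_tch_three _ _ _ ha2 ha1 ha)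
  have h_ob := exists_intertwiningMap_parabolicIndGL_ne_zero ΦD.range.quotientRep hV₂s (∏ i : Fin 3, ((![a * ((unramifiedTwist F 1 : QuasiChar F).toMonoidHom) * ((unramifiedTwist F 1 : QuasiChar F).toMonoidHom), a * ((unramifiedTwist F 1 : QuasiChar F).toMonoidHom), a] : Fin 3 → (Fˣ →* ℂˣ)) i).comp (Matrix.GeneralLinearGroup.det.comp (Pi.evalMonoidHom (fun t : Fin 3 => GL {i : Fin 3 // (id : Fin 3 → Fin 3) i = t} F) i))) (by rw [v2]; exact one_ne_zero)
  obtain ⟨Ψ, hΨ⟩ := h_ob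
  have h_ob := exists_injective_intertwiningMap_parabolicIndGL W hW (∏ i : Fin 3, ((![a * ((unramifiedTwist F 1 : QuasiChar F).toMonoidHom) * ((unramifiedTwist F 1 : QuasiChar F).toMonoidHom), a * ((unramifiedTwist F 1 : QuasiChar F).toMonoidHom), a] : Fin 3 → (Fˣ →* ℂˣ)) i).comp (Matrix.GeneralLinearGroup.det.comp (Pi.evalMonoidHom (fun t : Fin 3 => GL {i : Fin 3 // (id : Fin 3 → Fin 3) i = t} F) i))) h
  obtain ⟨ΦW, hΦW⟩ := h_ob
  have hle := range_le_range_of_weight_C₂ a ha ΦD W h Ψ hΨ ΦW hΦW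
  have h_ob := nonempty_equiv_range ΦW hΦW
  obtain ⟨eW⟩ := h_ob
  -- `P := Ψ⁻¹(W)`, `T := ker (Ψ|_P)`, `P ⁄ T ≅ W`
  let P : Subrepresentation ΦD.range.quotientRep :=
    ⟨ΦW.range.toSubmodule.comap Ψ.toLinearMap, fun g v hv => by
      change Ψ.toLinearMap (ΦD.range.quotientRep g v) ∈ ΦW.range.toSubmodule
      rw [Representation.IntertwiningMap.toLinearMap_apply, Representation.IntertwiningMap.isIntertwining]
      exact ΦW.range.apply_mem_toSubmodule g hv⟩
  have h_ob := nonempty_equiv_quotientRep_ker Ψ ΦW.range hle P rfl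
  obtain ⟨eT⟩ := h_ob
  exact ⟨P, _, ⟨eT.trans eW.symm⟩⟩

set_option maxHeartbeats 400000 in
include ha in
/-- **THE TWO PIECES OF `V₂` AROUND `W`** (`maxHeartbeats 400000`: the budget is cumulative over the three `linarith` certificates on the three-level subquotient
`T ≤ P ≤ I C₁ ⁄ D`; no single step is slow): for `T ≤ P ≤ V₂` with `P ⁄ T ≅ W` (`W` irreducible smooth, `mult W (wt C₂) ≠ 0`): `E(W) = {{C₂}}` (C₄ excluded by ★ C2b′, the rest by `E(V₂)`),
so the weights of `T` and `V₂ ⁄ P` add up to `{{C₄ ↦ 1, C₄′ ↦ 1}}` (★ ADD `finrank_weightSpace_eq_add_add`) and §2 gives `tr T + tr (V₂⁄P) = tr D′ − tr π₁`; with `tr P = tr T + tr W`: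
`tr P − tr W + tr (V₂ ⁄ P) = tr D′ − tr π₁`. [cite: Zelevinsky1980, Thm. 6.1, Cor. 7.5, §9] [cite: BernsteinZelevinsky1977, §2.3] -/
theorem smoothTrace_pieces [FiniteDimensional ℂ (Representation.restrictUnipotentGL F (id : Fin 3 → Fin 3) (Representation.parabolicIndGL F (![false, false, true] : Fin 3 → Bool) ((Representation.trivial ℂ (Π t : Bool, GL {i : Fin 3 // (![false, false, true] : Fin 3 → Bool) i = t} F) ℂ).twist ((a * ((unramifiedTwist F (1 / 2) : QuasiChar F).toMonoidHom)).comp ((Matrix.GeneralLinearGroup.det : GL {i : Fin 3 // (![false, false, true] : Fin 3 → Bool) i = false} F →* Fˣ).comp (Pi.evalMonoidHom (fun t : Bool => GL {i : Fin 3 // (![false, false, true] : Fin 3 → Bool) i = t} F) false)) * (a * ((unramifiedTwist F 1 : QuasiChar F).toMonoidHom) * ((unramifiedTwist F 1 : QuasiChar F).toMonoidHom)).comp ((Matrix.GeneralLinearGroup.det : GL {i : Fin 3 // (![false, false, true] : Fin 3 → Bool) i = true} F →* Fˣ).comp (Pi.evalMonoidHom (fun t : Bool => GL {i : Fin 3 //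 (![false, false, true] : Fin 3 → Bool) i = t} F) true)))))).Coinvariants] [FiniteDimensional ℂ (Representation.restrictUnipotentGL F (id : Fin 3 → Fin 3) (Representation.parabolicIndGL F (![false, false, true] : Fin 3 → Bool) ((Representation.trivial ℂ (Π t : Bool, GL {i : Fin 3 // (![false, false, true] : Fin 3 → Bool) i = t} F) ℂ).twist ((a * ((unramifiedTwist F 1 : QuasiChar F).toMonoidHom) * ((unramifiedTwist F (1 / 2) : QuasiChar F).toMonoidHom)).comp ((Matrix.GeneralLinearGroup.det : GL {i : Fin 3 // (![false, false, true] : Fin 3 → Bool) i = false} F →* Fˣ).comp (Pi.evalMonoidHom (fun t : Bool => GL {i : Fin 3 // (![false, false, true] : Fin 3 → Bool) i = t} F) false)) * (a).comp ((Matrix.GeneralLinearGroup.det : GL {i : Fin 3 // (![false, false, true] : Fin 3 → Bool) i = true} F →* Fˣ).comp (Pi.evalMonoidHom (fun t : Bool => GL {i : Fin 3 // (![false, false, true] : Fin 3 → Bool) i = t} F) true)))))).Coinvariants]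
    (hD : ∀ ζ : (Π t : Fin 3, GL {i : Fin 3 // (id : Fin 3 → Fin 3) i = t} F) → ℂ, finrank ℂ ↥(⨅ m, Module.End.maxGenEigenspace (Representation.normalizedJacquetGL F (id : Fin 3 → Fin 3) (Representation.parabolicIndGL F (![false, false, true] : Fin 3 → Bool) ((Representation.trivial ℂ (Π t : Bool, GL {i : Fin 3 // (![false, false, true] : Fin 3 → Bool) i = t} F) ℂ).twist ((a * ((unramifiedTwist F (1 / 2) : QuasiChar F).toMonoidHom)).comp ((Matrix.GeneralLinearGroup.det : GL {i : Fin 3 // (![false, false, true] : Fin 3 → Bool) i = false} F →* Fˣ).comp (Pi.evalMonoidHom (fun t : Bool => GL {i : Fin 3 // (![false, false, true] : Fin 3 → Bool) i = t} F) false)) * (a * ((unramifiedTwist F 1 : QuasiChar F).toMonoidHom) * ((unramifiedTwist F 1 : QuasiChar F).toMonoidHom)).comp ((Matrix.GeneralLinearGroup.det : GL {i : Fin 3 // (![false, false, true] : Fin 3 → Bool) i = true} F →* Fˣ).comp (Pi.evalMonoidHom (fun t : Bool => GL {i : Fin 3 // (![false, false, true] : Fin 3 → Bool) i = t} F) true)))))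 m) (ζ m)) =
      (if ζ = (fun m : (Π t : Fin 3, GL {i : Fin 3 // (id : Fin 3 → Fin 3) i = t} F) => ((((∏ i : Fin 3, ((![a, a * ((unramifiedTwist F 1 : QuasiChar F).toMonoidHom), a * ((unramifiedTwist F 1 : QuasiChar F).toMonoidHom) * ((unramifiedTwist F 1 : QuasiChar F).toMonoidHom)] : Fin 3 → (Fˣ →* ℂˣ)) i).comp (Matrix.GeneralLinearGroup.det.comp (Pi.evalMonoidHom (fun t : Fin 3 => GL {i : Fin 3 // (id : Fin 3 → Fin 3) i = t} F) i)))) m : ℂˣ) : ℂ)) then 1 else 0) + (if ζ = (fun m : (Π t : Fin 3, GL {i : Fin 3 // (id : Fin 3 → Fin 3) i = t} F) => ((((∏ i : Fin 3, ((![a, a * ((unramifiedTwist F 1 : QuasiChar F).toMonoidHom) * ((unramifiedTwist F 1 : QuasiChar F).toMonoidHom), a * ((unramifiedTwist F 1 : QuasiChar F).toMonoidHom)] : Fin 3 → (Fˣ →* ℂˣ)) i).comp (Matrix.GeneralLinearGroup.det.comp (Pi.evalMonoidHom (fun t : Fin 3 => GL {i : Fin 3 // (id : Fin 3 → Fin 3)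 i = t} F) i)))) m : ℂˣ) : ℂ)) then 1 else 0) + (if ζ = (fun m : (Π t : Fin 3, GL {i : Fin 3 // (id : Fin 3 → Fin 3) i = t} F) => ((((∏ i : Fin 3, ((![a * ((unramifiedTwist F 1 : QuasiChar F).toMonoidHom) * ((unramifiedTwist F 1 : QuasiChar F).toMonoidHom), a, a * ((unramifiedTwist F 1 : QuasiChar F).toMonoidHom)] : Fin 3 → (Fˣ →* ℂˣ)) i).comp (Matrix.GeneralLinearGroup.det.comp (Pi.evalMonoidHom (fun t : Fin 3 => GL {i : Fin 3 // (id : Fin 3 → Fin 3) i = t} F) i)))) m : ℂˣ) : ℂ)) then 1 else 0))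
    (hD' : ∀ ζ : (Π t : Fin 3, GL {i : Fin 3 // (id : Fin 3 → Fin 3) i = t} F) → ℂ, finrank ℂ ↥(⨅ m, Module.End.maxGenEigenspace (Representation.normalizedJacquetGL F (id : Fin 3 → Fin 3) (Representation.parabolicIndGL F (![false, false, true] : Fin 3 → Bool) ((Representation.trivial ℂ (Π t : Bool, GL {i : Fin 3 // (![false, false, true] : Fin 3 → Bool) i = t} F) ℂ).twist ((a * ((unramifiedTwist F 1 : QuasiChar F).toMonoidHom) * ((unramifiedTwist F (1 / 2) : QuasiChar F).toMonoidHom)).comp ((Matrix.GeneralLinearGroup.det : GL {i : Fin 3 // (![false, false, true] : Fin 3 → Bool) i = false} F →* Fˣ).comp (Pi.evalMonoidHom (fun t : Bool => GL {i : Fin 3 // (![false, false, true] : Fin 3 → Bool) i = t} F) false)) * (a).comp ((Matrix.GeneralLinearGroup.det : GL {i : Fin 3 // (![false, false, true] : Fin 3 → Bool) i = true} F →* Fˣ).comp (Pi.evalMonoidHom (fun t : Bool => GL {i : Fin 3 // (![false, false, true] : Fin 3 → Bool) i = t} F) true))))) m) (ζ m)) =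
      (if ζ = (fun m : (Π t : Fin 3, GL {i : Fin 3 // (id : Fin 3 → Fin 3) i = t} F) => ((((∏ i : Fin 3, ((![a * ((unramifiedTwist F 1 : QuasiChar F).toMonoidHom), a * ((unramifiedTwist F 1 : QuasiChar F).toMonoidHom) * ((unramifiedTwist F 1 : QuasiChar F).toMonoidHom), a] : Fin 3 → (Fˣ →* ℂˣ)) i).comp (Matrix.GeneralLinearGroup.det.comp (Pi.evalMonoidHom (fun t : Fin 3 => GL {i : Fin 3 // (id : Fin 3 → Fin 3) i = t} F) i)))) m : ℂˣ) : ℂ)) then 1 else 0) + (if ζ = (fun m : (Π t : Fin 3, GL {i : Fin 3 // (id : Fin 3 → Fin 3) i = t} F) => ((((∏ i : Fin 3, ((![a * ((unramifiedTwist F 1 : QuasiChar F).toMonoidHom), a, a * ((unramifiedTwist F 1 : QuasiChar F).toMonoidHom) * ((unramifiedTwist F 1 : QuasiChar F).toMonoidHom)] : Fin 3 → (Fˣ →* ℂˣ)) i).comp (Matrix.GeneralLinearGroup.det.comp (Pi.evalMonoidHom (fun t : Fin 3 => GL {i : Fin 3 // (id : Fin 3 → Fin 3) i = t} F) i)))) m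 : ℂˣ) : ℂ)) then 1 else 0) + (if ζ = (fun m : (Π t : Fin 3, GL {i : Fin 3 // (id : Fin 3 → Fin 3) i = t} F) => ((((∏ i : Fin 3, ((![a, a * ((unramifiedTwist F 1 : QuasiChar F).toMonoidHom), a * ((unramifiedTwist F 1 : QuasiChar F).toMonoidHom) * ((unramifiedTwist F 1 : QuasiChar F).toMonoidHom)] : Fin 3 → (Fˣ →* ℂˣ)) i).comp (Matrix.GeneralLinearGroup.det.comp (Pi.evalMonoidHom (fun t : Fin 3 => GL {i : Fin 3 // (id : Fin 3 → Fin 3) i = t} F) i)))) m : ℂˣ) : ℂ)) then 1 else 0))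
    (hS₁₂ : ∀ {Y : Type} [AddCommGroup Y] [Module ℂ Y] (V : Representation ℂ (GL (Fin 3) F) Y), V.IsSmooth → ∀ [FiniteDimensional ℂ (Representation.restrictUnipotentGL F (id : Fin 3 → Fin 3) V).Coinvariants],
      finrank ℂ ↥(⨅ m, Module.End.maxGenEigenspace (Representation.normalizedJacquetGL F (id : Fin 3 → Fin 3) V m) (((((∏ i : Fin 3, ((![a * ((unramifiedTwist F 1 : QuasiChar F).toMonoidHom), a, a * ((unramifiedTwist F 1 : QuasiChar F).toMonoidHom) * ((unramifiedTwist F 1 : QuasiChar F).toMonoidHom)] : Fin 3 → (Fˣ →* ℂˣ)) i).comp (Matrix.GeneralLinearGroup.det.comp (Pi.evalMonoidHom (fun t : Fin 3 => GL {i : Fin 3 // (id : Fin 3 → Fin 3) i = t} F) i)))) m : ℂˣ) : ℂ))) =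
        finrank ℂ ↥(⨅ m, Module.End.maxGenEigenspace (Representation.normalizedJacquetGL F (id : Fin 3 → Fin 3) V m) (((((∏ i : Fin 3, ((![a * ((unramifiedTwist F 1 : QuasiChar F).toMonoidHom), a * ((unramifiedTwist F 1 : QuasiChar F).toMonoidHom) * ((unramifiedTwist F 1 : QuasiChar F).toMonoidHom), a] : Fin 3 → (Fˣ →* ℂˣ)) i).comp (Matrix.GeneralLinearGroup.det.comp (Pi.evalMonoidHom (fun t : Fin 3 => GL {i : Fin 3 // (id : Fin 3 → Fin 3) i = t} F) i)))) m : ℂˣ) : ℂ))))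
    (hJ₁ : (∀ r : SmoothIrrep (GL (Fin 3) F), (IrrClass.mk r).IsConstituentOf (Representation.parabolicIndGL F (id : Fin 3 → Fin 3) ((Representation.trivial ℂ (Π t : Fin 3, GL {i : Fin 3 // (id : Fin 3 → Fin 3) i = t} F) ℂ).twist (∏ i : Fin 3, ((![a, a * ((unramifiedTwist F 1 : QuasiChar F).toMonoidHom), a * ((unramifiedTwist F 1 : QuasiChar F).toMonoidHom) * ((unramifiedTwist F 1 : QuasiChar F).toMonoidHom)] : Fin 3 → (Fˣ →* ℂˣ)) i).comp (Matrix.GeneralLinearGroup.det.comp (Pi.evalMonoidHom (fun t : Fin 3 => GL {i : Fin 3 // (id : Fin 3 → Fin 3) i = t} F) i))))) → Nontrivial (Representation.restrictUnipotentGL F (id : Fin 3 → Fin 3) r.ρ).Coinvariants))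
    (hJ₄' : (∀ r : SmoothIrrep (GL (Fin 3) F), (IrrClass.mk r).IsConstituentOf (Representation.parabolicIndGL F (id : Fin 3 → Fin 3) ((Representation.trivial ℂ (Π t : Fin 3, GL {i : Fin 3 // (id : Fin 3 → Fin 3) i = t} F) ℂ).twist (∏ i : Fin 3, ((![a * ((unramifiedTwist F 1 : QuasiChar F).toMonoidHom), a * ((unramifiedTwist F 1 : QuasiChar F).toMonoidHom) * ((unramifiedTwist F 1 : QuasiChar F).toMonoidHom), a] : Fin 3 → (Fˣ →* ℂˣ)) i).comp (Matrix.GeneralLinearGroup.det.comp (Pi.evalMonoidHom (fun t : Fin 3 => GL {i : Fin 3 // (id : Fin 3 → Fin 3) i = t} F) i))))) → Nontrivial (Representation.restrictUnipotentGL F (id : Fin 3 → Fin 3) r.ρ).Coinvariants))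
    (ΦD : (Representation.parabolicIndGL F (![false, false, true] : Fin 3 → Bool) ((Representation.trivial ℂ (Π t : Bool, GL {i : Fin 3 // (![false, false, true] : Fin 3 → Bool) i = t} F) ℂ).twist ((a * ((unramifiedTwist F (1 / 2) : QuasiChar F).toMonoidHom)).comp ((Matrix.GeneralLinearGroup.det : GL {i : Fin 3 // (![false, false, true] : Fin 3 → Bool) i = false} F →* Fˣ).comp (Pi.evalMonoidHom (fun t : Bool => GL {i : Fin 3 // (![false, false, true] : Fin 3 → Bool) i = t} F) false)) * (a * ((unramifiedTwist F 1 : QuasiChar F).toMonoidHom) * ((unramifiedTwist F 1 : QuasiChar F).toMonoidHom)).comp ((Matrix.GeneralLinearGroup.det : GL {i : Fin 3 // (![false, false, true] : Fin 3 → Bool) i = true} F →* Fˣ).comp (Pi.evalMonoidHom (fun t : Bool => GL {i : Fin 3 // (![false, false, true] : Fin 3 → Bool) i = t} F) true))))).IntertwiningMap (Representation.parabolicIndGL F (id : Fin 3 → Fin 3) ((Representation.trivial ℂ (Π t : Fin 3, GL {i : Fin 3 // (id : Fin 3 → Fin 3) i = t} F) ℂ).twist (∏ i : Fin 3, ((![a,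 a * ((unramifiedTwist F 1 : QuasiChar F).toMonoidHom), a * ((unramifiedTwist F 1 : QuasiChar F).toMonoidHom) * ((unramifiedTwist F 1 : QuasiChar F).toMonoidHom)] : Fin 3 → (Fˣ →* ℂˣ)) i).comp (Matrix.GeneralLinearGroup.det.comp (Pi.evalMonoidHom (fun t : Fin 3 => GL {i : Fin 3 // (id : Fin 3 → Fin 3) i = t} F) i)))))) (hΦD : Function.Injective ΦD) {Y : Type} [AddCommGroup Y] [Module ℂ Y] (W : Representation ℂ (GL (Fin 3) F) Y) [W.IsIrreducible] (hW : W.IsSmooth)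
    [FiniteDimensional ℂ (Representation.restrictUnipotentGL F (id : Fin 3 → Fin 3) W).Coinvariants]
    (h : finrank ℂ ↥(⨅ m, Module.End.maxGenEigenspace (Representation.normalizedJacquetGL F (id : Fin 3 → Fin 3) W m) (((((∏ i : Fin 3, ((![a * ((unramifiedTwist F 1 : QuasiChar F).toMonoidHom) * ((unramifiedTwist F 1 : QuasiChar F).toMonoidHom), a * ((unramifiedTwist F 1 : QuasiChar F).toMonoidHom), a] : Fin 3 → (Fˣ →* ℂˣ)) i).comp (Matrix.GeneralLinearGroup.det.comp (Pi.evalMonoidHom (fun t : Fin 3 => GL {i : Fin 3 // (id : Fin 3 → Fin 3) i = t} F) i)))) m : ℂˣ) : ℂ))) ≠ 0)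
    (P : Subrepresentation ΦD.range.quotientRep) (T : Subrepresentation P.toRepresentation) (e : T.quotientRep.Equiv W)
    [MeasurableSpace (GL (Fin 3) F)] [BorelSpace (GL (Fin 3) F)] (μ : Measure (GL (Fin 3) F)) [IsFiniteMeasureOnCompacts μ] (f : GL (Fin 3) F → ℂ) :
    P.toRepresentation.smoothTrace μ f - W.smoothTrace μ f + P.quotientRep.smoothTrace μ f = (Representation.parabolicIndGL F (![false, false, true] : Fin 3 → Bool) ((Representation.trivial ℂ (Π t : Bool, GL {i : Fin 3 // (![false, false, true] : Fin 3 → Bool) i = t} F) ℂ).twist ((a * ((unramifiedTwist F 1 : QuasiChar F).toMonoidHom) * ((unramifiedTwist F (1 / 2) : QuasiChar F).toMonoidHom)).comp ((Matrix.GeneralLinearGroup.det : GL {i : Fin 3 // (![false, false, true] : Fin 3 → Bool) i = false} F →* Fˣ).comp (Pi.evalMonoidHom (fun t : Bool => GL {i : Fin 3 // (![false, false, true] : Fin 3 → Bool) i = t} F) false)) * (a).comp ((Matrix.GeneralLinearGroup.det : GL {i : Fin 3 // (![false, false, true] : Fin 3 → Bool) i = true} F →* Fˣ).comp (Pi.evalMonoidHom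 (fun t : Bool => GL {i : Fin 3 // (![false, false, true] : Fin 3 → Bool) i = t} F) true))))).smoothTrace μ f - ((Representation.trivial ℂ (GL (Fin 3) F) ℂ).twist ((a * ((unramifiedTwist F 1 : QuasiChar F).toMonoidHom)).comp (Matrix.GeneralLinearGroup.det : GL (Fin 3) F →* Fˣ))).smoothTrace μ f := by
  have h_ob := cube_letters_ne a
  obtain ⟨h1, h2, h3, -⟩ := h_ob
  have n24 : (fun m : (Π t : Fin 3, GL {i : Fin 3 // (id : Fin 3 → Fin 3) i = t} F) => ((((∏ i : Fin 3, ((![a * ((unramifiedTwist F 1 : QuasiChar F).toMonoidHom) * ((unramifiedTwist F 1 : QuasiChar F).toMonoidHom), a * ((unramifiedTwist F 1 : QuasiChar F).toMonoidHom), a] : Fin 3 → (Fˣ →* ℂˣ)) i).comp (Matrix.GeneralLinearGroup.det.comp (Pi.evalMonoidHom (fun t : Fin 3 => GL {i : Fin 3 // (id : Fin 3 → Fin 3) i = t} F) i)))) m : ℂˣ) : ℂ)) ≠ (fun m : (Π t : Fin 3, GL {i : Fin 3 // (id : Fin 3 → Fin 3) i = t} F) => ((((∏ i : Fin 3, ((![a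 * ((unramifiedTwist F 1 : QuasiChar F).toMonoidHom), a, a * ((unramifiedTwist F 1 : QuasiChar F).toMonoidHom) * ((unramifiedTwist F 1 : QuasiChar F).toMonoidHom)] : Fin 3 → (Fˣ →* ℂˣ)) i).comp (Matrix.GeneralLinearGroup.det.comp (Pi.evalMonoidHom (fun t : Fin 3 => GL {i : Fin 3 // (id : Fin 3 → Fin 3) i = t} F) i)))) m : ℂˣ) : ℂ)) := wt_ne_of_apply_ne _ _ 0 (by simpa using h3); have n24p : (fun m : (Π t : Fin 3, GL {i : Fin 3 // (id : Fin 3 → Fin 3) i = t} F) => ((((∏ i : Fin 3, ((![a * ((unramifiedTwist F 1 : QuasiChar F).toMonoidHom) * ((unramifiedTwist F 1 : QuasiChar F).toMonoidHom), a * ((unramifiedTwist F 1 : QuasiChar F).toMonoidHom), a] : Fin 3 → (Fˣ →* ℂˣ)) i).comp (Matrix.GeneralLinearGroup.det.comp (Pi.evalMonoidHom (fun t : Fin 3 => GL {i : Fin 3 // (id : Fin 3 → Fin 3) i = t} F) i)))) m : ℂˣ) : ℂ)) ≠ (fun m : (Π t : Fin 3, GL {i : Fin 3 // (id : Fin 3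 → Fin 3) i = t} F) => ((((∏ i : Fin 3, ((![a * ((unramifiedTwist F 1 : QuasiChar F).toMonoidHom), a * ((unramifiedTwist F 1 : QuasiChar F).toMonoidHom) * ((unramifiedTwist F 1 : QuasiChar F).toMonoidHom), a] : Fin 3 → (Fˣ →* ℂˣ)) i).comp (Matrix.GeneralLinearGroup.det.comp (Pi.evalMonoidHom (fun t : Fin 3 => GL {i : Fin 3 // (id : Fin 3 → Fin 3) i = t} F) i)))) m : ℂˣ) : ℂ)) := wt_ne_of_apply_ne _ _ 0 (by simpa using h3)
  have h_ob := isOpen_ker_letters a ha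
  obtain ⟨ha1, ha2⟩ := h_ob
  have hIadm := isAdmissible_I_cube a ha; have hIs := hIadm.isSmooth
  haveI : FiniteDimensional ℂ (Representation.restrictUnipotentGL F (id : Fin 3 → Fin 3) (Representation.parabolicIndGL F (id : Fin 3 → Fin 3) ((Representation.trivial ℂ (Π t : Fin 3, GL {i : Fin 3 // (id : Fin 3 → Fin 3) i = t} F) ℂ).twist (∏ i : Fin 3, ((![a, a * ((unramifiedTwist F 1 : QuasiChar F).toMonoidHom), a * ((unramifiedTwist F 1 : QuasiChar F).toMonoidHom) * ((unramifiedTwist F 1 : QuasiChar F).toMonoidHom)] : Fin 3 → (Fˣ →* ℂˣ)) i).comp (Matrix.GeneralLinearGroup.det.comp (Pi.evalMonoidHom (fun t : Fin 3 => GL {i : Fin 3 // (id : Fin 3 → Fin 3) i = t} F) i)))))).Coinvariants := finiteDimensional_jacquet_principalSeries _ (isOpen_ker_tch_three _ _ _ ha ha1 ha2)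
  have hV₂adm : ΦD.range.quotientRep.IsAdmissible := hIadm.quotientRep ΦD.range
  have hV₂s := hV₂adm.isSmooth
  haveI := finiteDimensional_jacquet_quotientRep (c := (id : Fin 3 → Fin 3)) (Representation.parabolicIndGL F (id : Fin 3 → Fin 3) ((Representation.trivial ℂ (Π t : Fin 3, GL {i : Fin 3 // (id : Fin 3 → Fin 3) i = t} F) ℂ).twist (∏ i : Fin 3, ((![a, a * ((unramifiedTwist F 1 : QuasiChar F).toMonoidHom), a * ((unramifiedTwist F 1 : QuasiChar F).toMonoidHom) * ((unramifiedTwist F 1 : QuasiChar F).toMonoidHom)] : Fin 3 → (Fˣ →* ℂˣ)) i).comp (Matrix.GeneralLinearGroup.det.comp (Pi.evalMonoidHom (fun t : Fin 3 => GL {i : Fin 3 // (id : Fin 3 → Fin 3) i = t} F) i))))) ΦD.range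
  have hJV₂ : (∀ r : SmoothIrrep (GL (Fin 3) F), (IrrClass.mk r).IsConstituentOf ΦD.range.quotientRep → Nontrivial (Representation.restrictUnipotentGL F (id : Fin 3 → Fin 3) r.ρ).Coinvariants) := fun r hr => hJ₁ r (hr.of_quotientRep ΦD.range)
  have h_ob := weights_quotient_I_D_pos a ha hD ΦD hΦD
  obtain ⟨v2, v4, v4p⟩ := h_ob
  have v0 := weights_quotient_I_D_zero a ha hD ΦD hΦD
  -- `E(W)`: no C₄-class weight (★ C2b′)
  have w4 : finrank ℂ ↥(⨅ m, Module.End.maxGenEigenspace (Representation.normalizedJacquetGL F (id : Fin 3 → Fin 3) W m) (((((∏ i : Fin 3, ((![a * ((unramifiedTwist F 1 : QuasiChar F).toMonoidHom), a, a * ((unramifiedTwist F 1 : QuasiChar F).toMonoidHom) * ((unramifiedTwist F 1 : QuasiChar F).toMonoidHom)] : Fin 3 → (Fˣ →* ℂˣ)) i).comp (Matrix.GeneralLinearGroup.det.comp (Pi.evalMonoidHom (fun t : Fin 3 => GL {i : Fin 3 // (id : Fin 3 → Fin 3) i = t} F) i)))) m : ℂˣ) : ℂ))) = 0 := by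
    by_contra hne
    have h_ob := weights_of_weight_C₄ a ha hD' hS₁₂ W hW (Or.inl hne)
    obtain ⟨-, -, w0⟩ := h_ob
    exact h (w0 _ n24 n24p)
  have w4p : finrank ℂ ↥(⨅ m, Module.End.maxGenEigenspace (Representation.normalizedJacquetGL F (id : Fin 3 → Fin 3) W m) (((((∏ i : Fin 3, ((![a * ((unramifiedTwist F 1 : QuasiChar F).toMonoidHom), a * ((unramifiedTwist F 1 : QuasiChar F).toMonoidHom) * ((unramifiedTwist F 1 : QuasiChar F).toMonoidHom), a] : Fin 3 → (Fˣ →* ℂˣ)) i).comp (Matrix.GeneralLinearGroup.det.comp (Pi.evalMonoidHom (fun t : Fin 3 => GL {i : Fin 3 // (id : Fin 3 → Fin 3) i = t} F) i)))) m : ℂˣ) : ℂ))) = 0 := by rw [← hS₁₂ W hW]; exact w4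
  have hpos := Nat.pos_of_ne_zero h
  -- instances and bookkeeping on `T ≤ P ≤ V₂`
  have hPadm : P.toRepresentation.IsAdmissible := hV₂adm.toRepresentation P
  have hPs := hPadm.isSmooth
  haveI := finiteDimensional_jacquet_subrepresentation ΦD.range.quotientRep monotone_id hV₂s P
  haveI := finiteDimensional_jacquet_subrepresentation P.toRepresentation monotone_id hPs T
  haveI := finiteDimensional_jacquet_quotientRep (c := (id : Fin 3 → Fin 3)) ΦD.range.quotientRep P
  have hadd := fun ζ => finrank_weightSpace_eq_add_add ΦD.range.quotientRep hV₂s P T ζ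
  have hTW := fun ζ : (Π t : Fin 3, GL {i : Fin 3 // (id : Fin 3 → Fin 3) i = t} F) → ℂ => finrank_weightSpace_eq_of_equiv _ _ e ζ
  have key := @smoothTrace_add_of_weights_add_C₄ F _ _ _ _ a ha _ hD' hS₁₂ hJ₄' _ _ (Submodule.addCommGroup _) (Submodule.module _)
    (Submodule.Quotient.addCommGroup _) (Submodule.Quotient.module _) T.toRepresentation P.quotientRep
    (hPs.toRepresentation T) (hV₂s.of_surjective P.mkQ P.mkQ_surjective) _ _
    (fun r hr => hJV₂ r ((hr.of_subrepresentation T).of_subrepresentation P)) (fun r hr => hJV₂ r (hr.of_quotientRep P))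
    (by have e1 := hadd (fun m : (Π t : Fin 3, GL {i : Fin 3 // (id : Fin 3 → Fin 3) i = t} F) => ((((∏ i : Fin 3, ((![a * ((unramifiedTwist F 1 : QuasiChar F).toMonoidHom), a, a * ((unramifiedTwist F 1 : QuasiChar F).toMonoidHom) * ((unramifiedTwist F 1 : QuasiChar F).toMonoidHom)] : Fin 3 → (Fˣ →* ℂˣ)) i).comp (Matrix.GeneralLinearGroup.det.comp (Pi.evalMonoidHom (fun t : Fin 3 => GL {i : Fin 3 // (id : Fin 3 → Fin 3) i = t} F) i)))) m : ℂˣ) : ℂ)); have e2 := hTW (fun m : (Π t : Fin 3, GL {i : Fin 3 // (id : Fin 3 → Fin 3) i = t} F) => ((((∏ i : Fin 3, ((![a * ((unramifiedTwist F 1 : QuasiChar F).toMonoidHom), a, a * ((unramifiedTwist F 1 : QuasiChar F).toMonoidHom) * ((unramifiedTwist F 1 : QuasiChar F).toMonoidHom)] : Fin 3 → (Fˣ →* ℂˣ)) i).comp (Matrix.GeneralLinearGroup.det.comp (Pi.evalMonoidHom (fun t : Fin 3 => GL {i : Fin 3 // (id : Fin 3 → Fin 3) i = t} F) i)))) m :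 ℂˣ) : ℂ)); linarith only [e1, e2, v4, w4])
    (by have e1 := hadd (fun m : (Π t : Fin 3, GL {i : Fin 3 // (id : Fin 3 → Fin 3) i = t} F) => ((((∏ i : Fin 3, ((![a * ((unramifiedTwist F 1 : QuasiChar F).toMonoidHom), a * ((unramifiedTwist F 1 : QuasiChar F).toMonoidHom) * ((unramifiedTwist F 1 : QuasiChar F).toMonoidHom), a] : Fin 3 → (Fˣ →* ℂˣ)) i).comp (Matrix.GeneralLinearGroup.det.comp (Pi.evalMonoidHom (fun t : Fin 3 => GL {i : Fin 3 // (id : Fin 3 → Fin 3) i = t} F) i)))) m : ℂˣ) : ℂ)); have e2 := hTW (fun m : (Π t : Fin 3, GL {i : Fin 3 // (id : Fin 3 → Fin 3) i = t} F) => ((((∏ i : Fin 3, ((![a * ((unramifiedTwist F 1 : QuasiChar F).toMonoidHom), a * ((unramifiedTwist F 1 : QuasiChar F).toMonoidHom) * ((unramifiedTwist F 1 : QuasiChar F).toMonoidHom), a] : Fin 3 → (Fˣ →* ℂˣ)) i).comp (Matrix.GeneralLinearGroup.det.comp (Pi.evalMonoidHom (fun t : Fin 3 => GL {i : Fin 3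 // (id : Fin 3 → Fin 3) i = t} F) i)))) m : ℂˣ) : ℂ)); linarith only [e1, e2, v4p, w4p])
    (fun ζ hζ4 hζ4p => by
      have e1 := hadd ζ
      have e2 := hTW ζ
      by_cases hζ2 : ζ = (fun m : (Π t : Fin 3, GL {i : Fin 3 // (id : Fin 3 → Fin 3) i = t} F) => ((((∏ i : Fin 3, ((![a * ((unramifiedTwist F 1 : QuasiChar F).toMonoidHom) * ((unramifiedTwist F 1 : QuasiChar F).toMonoidHom), a * ((unramifiedTwist F 1 : QuasiChar F).toMonoidHom), a] : Fin 3 → (Fˣ →* ℂˣ)) i).comp (Matrix.GeneralLinearGroup.det.comp (Pi.evalMonoidHom (fun t : Fin 3 => GL {i : Fin 3 // (id : Fin 3 → Fin 3) i = t} F) i)))) m : ℂˣ) : ℂ))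
      · subst hζ2
        constructor <;> linarith only [e1, e2, v2, hpos]
      · have e3 := v0 ζ hζ2 hζ4 hζ4p
        constructor <;> linarith only [e1, e2, e3]) _ _ μ _ f
  have e3 := Representation.smoothTrace_eq_add_of_subrepresentation _ μ hPadm T f
  have e4 := congrFun (Representation.smoothTrace_eq_of_equiv _ μ e) f
  linear_combination e3 - e4 + key

include ha in
/-- **CLASS C₂ (STEINBERG), TRACE FORM: `tr W = tr I(C₁) − tr D − tr D′ + tr π₁`** for every irreducible smooth `W` (f.d. `r_B W`) with `mult W (wt C₂) ≠ 0` — orientation-free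
(module docstring §3; additivity of the character on the admissible `I C₁ ↠ V₂ ⊇ P ⊇ T`). [cite: Zelevinsky1980, Thm. 6.1, Cor. 7.5, §9] [cite: BernsteinZelevinsky1977, §2.3, Cor. 2.13, Thm. 2.9] -/
theorem smoothTrace_of_weight_C₂ [FiniteDimensional ℂ (Representation.restrictUnipotentGL F (id : Fin 3 → Fin 3) (Representation.parabolicIndGL F (![false, false, true] : Fin 3 → Bool) ((Representation.trivial ℂ (Π t : Bool, GL {i : Fin 3 // (![false, false, true] : Fin 3 → Bool) i = t} F) ℂ).twist ((a * ((unramifiedTwist F (1 / 2) : QuasiChar F).toMonoidHom)).comp ((Matrix.GeneralLinearGroup.det : GL {i : Fin 3 // (![false, false, true] : Fin 3 → Bool) i = false} F →* Fˣ).comp (Pi.evalMonoidHom (fun t : Bool => GL {i : Fin 3 // (![false, false, true] : Fin 3 → Bool) i = t} F) false)) * (a * ((unramifiedTwist F 1 : QuasiChar F).toMonoidHom) * ((unramifiedTwist F 1 : QuasiChar F).toMonoidHom)).comp ((Matrix.GeneralLinearGroup.det : GL {i : Fin 3 // (![false, false, true] : Fin 3 → Bool) i = true} F →* Fˣ).comp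 (Pi.evalMonoidHom (fun t : Bool => GL {i : Fin 3 // (![false, false, true] : Fin 3 → Bool) i = t} F) true)))))).Coinvariants] [FiniteDimensional ℂ (Representation.restrictUnipotentGL F (id : Fin 3 → Fin 3) (Representation.parabolicIndGL F (![false, false, true] : Fin 3 → Bool) ((Representation.trivial ℂ (Π t : Bool, GL {i : Fin 3 // (![false, false, true] : Fin 3 → Bool) i = t} F) ℂ).twist ((a * ((unramifiedTwist F 1 : QuasiChar F).toMonoidHom) * ((unramifiedTwist F (1 / 2) : QuasiChar F).toMonoidHom)).comp ((Matrix.GeneralLinearGroup.det : GL {i : Fin 3 // (![false, false, true] : Fin 3 → Bool) i = false} F →* Fˣ).comp (Pi.evalMonoidHom (fun t : Bool => GL {i : Fin 3 // (![false, false, true] : Fin 3 → Bool) i = t} F) false)) * (a).comp ((Matrix.GeneralLinearGroup.det : GL {i : Fin 3 // (![false, false, true] : Fin 3 → Bool) i = true} F →* Fˣ).comp (Pi.evalMonoidHom (fun t : Bool => GL {i : Fin 3 // (![false, false, true] : Fin 3 → Bool) i = t} F) true)))))).Coinvariants]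
    (hD : ∀ ζ : (Π t : Fin 3, GL {i : Fin 3 // (id : Fin 3 → Fin 3) i = t} F) → ℂ, finrank ℂ ↥(⨅ m, Module.End.maxGenEigenspace (Representation.normalizedJacquetGL F (id : Fin 3 → Fin 3) (Representation.parabolicIndGL F (![false, false, true] : Fin 3 → Bool) ((Representation.trivial ℂ (Π t : Bool, GL {i : Fin 3 // (![false, false, true] : Fin 3 → Bool) i = t} F) ℂ).twist ((a * ((unramifiedTwist F (1 / 2) : QuasiChar F).toMonoidHom)).comp ((Matrix.GeneralLinearGroup.det : GL {i : Fin 3 // (![false, false, true] : Fin 3 → Bool) i = false} F →* Fˣ).comp (Pi.evalMonoidHom (fun t : Bool => GL {i : Fin 3 // (![false, false, true] : Fin 3 → Bool) i = t} F) false)) * (a * ((unramifiedTwist F 1 : QuasiChar F).toMonoidHom) * ((unramifiedTwist F 1 : QuasiChar F).toMonoidHom)).comp ((Matrix.GeneralLinearGroup.det : GL {i : Fin 3 // (![false, false, true] : Fin 3 → Bool) i = true} F →* Fˣ).comp (Pi.evalMonoidHom (fun t : Bool => GL {i : Fin 3 // (![false, false, true] : Fin 3 → Bool) i = t} F) true)))))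 m) (ζ m)) =
      (if ζ = (fun m : (Π t : Fin 3, GL {i : Fin 3 // (id : Fin 3 → Fin 3) i = t} F) => ((((∏ i : Fin 3, ((![a, a * ((unramifiedTwist F 1 : QuasiChar F).toMonoidHom), a * ((unramifiedTwist F 1 : QuasiChar F).toMonoidHom) * ((unramifiedTwist F 1 : QuasiChar F).toMonoidHom)] : Fin 3 → (Fˣ →* ℂˣ)) i).comp (Matrix.GeneralLinearGroup.det.comp (Pi.evalMonoidHom (fun t : Fin 3 => GL {i : Fin 3 // (id : Fin 3 → Fin 3) i = t} F) i)))) m : ℂˣ) : ℂ)) then 1 else 0) + (if ζ = (fun m : (Π t : Fin 3, GL {i : Fin 3 // (id : Fin 3 → Fin 3) i = t} F) => ((((∏ i : Fin 3, ((![a, a * ((unramifiedTwist F 1 : QuasiChar F).toMonoidHom) * ((unramifiedTwist F 1 : QuasiChar F).toMonoidHom), a * ((unramifiedTwist F 1 : QuasiChar F).toMonoidHom)] : Fin 3 → (Fˣ →* ℂˣ)) i).comp (Matrix.GeneralLinearGroup.det.comp (Pi.evalMonoidHom (fun t : Fin 3 => GL {i : Fin 3 // (id : Fin 3 → Fin 3)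 i = t} F) i)))) m : ℂˣ) : ℂ)) then 1 else 0) + (if ζ = (fun m : (Π t : Fin 3, GL {i : Fin 3 // (id : Fin 3 → Fin 3) i = t} F) => ((((∏ i : Fin 3, ((![a * ((unramifiedTwist F 1 : QuasiChar F).toMonoidHom) * ((unramifiedTwist F 1 : QuasiChar F).toMonoidHom), a, a * ((unramifiedTwist F 1 : QuasiChar F).toMonoidHom)] : Fin 3 → (Fˣ →* ℂˣ)) i).comp (Matrix.GeneralLinearGroup.det.comp (Pi.evalMonoidHom (fun t : Fin 3 => GL {i : Fin 3 // (id : Fin 3 → Fin 3) i = t} F) i)))) m : ℂˣ) : ℂ)) then 1 else 0))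
    (hD' : ∀ ζ : (Π t : Fin 3, GL {i : Fin 3 // (id : Fin 3 → Fin 3) i = t} F) → ℂ, finrank ℂ ↥(⨅ m, Module.End.maxGenEigenspace (Representation.normalizedJacquetGL F (id : Fin 3 → Fin 3) (Representation.parabolicIndGL F (![false, false, true] : Fin 3 → Bool) ((Representation.trivial ℂ (Π t : Bool, GL {i : Fin 3 // (![false, false, true] : Fin 3 → Bool) i = t} F) ℂ).twist ((a * ((unramifiedTwist F 1 : QuasiChar F).toMonoidHom) * ((unramifiedTwist F (1 / 2) : QuasiChar F).toMonoidHom)).comp ((Matrix.GeneralLinearGroup.det : GL {i : Fin 3 // (![false, false, true] : Fin 3 → Bool) i = false} F →* Fˣ).comp (Pi.evalMonoidHom (fun t : Bool => GL {i : Fin 3 // (![false, false, true] : Fin 3 → Bool) i = t} F) false)) * (a).comp ((Matrix.GeneralLinearGroup.det : GL {i : Fin 3 // (![false, false, true] : Fin 3 → Bool) i = true} F →* Fˣ).comp (Pi.evalMonoidHom (fun t : Bool => GL {i : Fin 3 // (![false, false, true] : Fin 3 → Bool) i = t} F) true))))) m) (ζ m)) =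
      (if ζ = (fun m : (Π t : Fin 3, GL {i : Fin 3 // (id : Fin 3 → Fin 3) i = t} F) => ((((∏ i : Fin 3, ((![a * ((unramifiedTwist F 1 : QuasiChar F).toMonoidHom), a * ((unramifiedTwist F 1 : QuasiChar F).toMonoidHom) * ((unramifiedTwist F 1 : QuasiChar F).toMonoidHom), a] : Fin 3 → (Fˣ →* ℂˣ)) i).comp (Matrix.GeneralLinearGroup.det.comp (Pi.evalMonoidHom (fun t : Fin 3 => GL {i : Fin 3 // (id : Fin 3 → Fin 3) i = t} F) i)))) m : ℂˣ) : ℂ)) then 1 else 0) + (if ζ = (fun m : (Π t : Fin 3, GL {i : Fin 3 // (id : Fin 3 → Fin 3) i = t} F) => ((((∏ i : Fin 3, ((![a * ((unramifiedTwist F 1 : QuasiChar F).toMonoidHom), a, a * ((unramifiedTwist F 1 : QuasiChar F).toMonoidHom) * ((unramifiedTwist F 1 : QuasiChar F).toMonoidHom)] : Fin 3 → (Fˣ →* ℂˣ)) i).comp (Matrix.GeneralLinearGroup.det.comp (Pi.evalMonoidHom (fun t : Fin 3 => GL {i : Fin 3 // (id : Fin 3 → Fin 3) i = t} F) i)))) m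 : ℂˣ) : ℂ)) then 1 else 0) + (if ζ = (fun m : (Π t : Fin 3, GL {i : Fin 3 // (id : Fin 3 → Fin 3) i = t} F) => ((((∏ i : Fin 3, ((![a, a * ((unramifiedTwist F 1 : QuasiChar F).toMonoidHom), a * ((unramifiedTwist F 1 : QuasiChar F).toMonoidHom) * ((unramifiedTwist F 1 : QuasiChar F).toMonoidHom)] : Fin 3 → (Fˣ →* ℂˣ)) i).comp (Matrix.GeneralLinearGroup.det.comp (Pi.evalMonoidHom (fun t : Fin 3 => GL {i : Fin 3 // (id : Fin 3 → Fin 3) i = t} F) i)))) m : ℂˣ) : ℂ)) then 1 else 0))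
    (hS₁₂ : ∀ {Y : Type} [AddCommGroup Y] [Module ℂ Y] (V : Representation ℂ (GL (Fin 3) F) Y), V.IsSmooth → ∀ [FiniteDimensional ℂ (Representation.restrictUnipotentGL F (id : Fin 3 → Fin 3) V).Coinvariants],
      finrank ℂ ↥(⨅ m, Module.End.maxGenEigenspace (Representation.normalizedJacquetGL F (id : Fin 3 → Fin 3) V m) (((((∏ i : Fin 3, ((![a * ((unramifiedTwist F 1 : QuasiChar F).toMonoidHom), a, a * ((unramifiedTwist F 1 : QuasiChar F).toMonoidHom) * ((unramifiedTwist F 1 : QuasiChar F).toMonoidHom)] : Fin 3 → (Fˣ →* ℂˣ)) i).comp (Matrix.GeneralLinearGroup.det.comp (Pi.evalMonoidHom (fun t : Fin 3 => GL {i : Fin 3 // (id : Fin 3 → Fin 3) i = t} F) i)))) m : ℂˣ) : ℂ))) =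
        finrank ℂ ↥(⨅ m, Module.End.maxGenEigenspace (Representation.normalizedJacquetGL F (id : Fin 3 → Fin 3) V m) (((((∏ i : Fin 3, ((![a * ((unramifiedTwist F 1 : QuasiChar F).toMonoidHom), a * ((unramifiedTwist F 1 : QuasiChar F).toMonoidHom) * ((unramifiedTwist F 1 : QuasiChar F).toMonoidHom), a] : Fin 3 → (Fˣ →* ℂˣ)) i).comp (Matrix.GeneralLinearGroup.det.comp (Pi.evalMonoidHom (fun t : Fin 3 => GL {i : Fin 3 // (id : Fin 3 → Fin 3) i = t} F) i)))) m : ℂˣ) : ℂ))))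
    (hJ₁ : (∀ r : SmoothIrrep (GL (Fin 3) F), (IrrClass.mk r).IsConstituentOf (Representation.parabolicIndGL F (id : Fin 3 → Fin 3) ((Representation.trivial ℂ (Π t : Fin 3, GL {i : Fin 3 // (id : Fin 3 → Fin 3) i = t} F) ℂ).twist (∏ i : Fin 3, ((![a, a * ((unramifiedTwist F 1 : QuasiChar F).toMonoidHom), a * ((unramifiedTwist F 1 : QuasiChar F).toMonoidHom) * ((unramifiedTwist F 1 : QuasiChar F).toMonoidHom)] : Fin 3 → (Fˣ →* ℂˣ)) i).comp (Matrix.GeneralLinearGroup.det.comp (Pi.evalMonoidHom (fun t : Fin 3 => GL {i : Fin 3 // (id : Fin 3 → Fin 3) i = t} F) i))))) → Nontrivial (Representation.restrictUnipotentGL F (id : Fin 3 → Fin 3) r.ρ).Coinvariants))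
    (hJ₄' : (∀ r : SmoothIrrep (GL (Fin 3) F), (IrrClass.mk r).IsConstituentOf (Representation.parabolicIndGL F (id : Fin 3 → Fin 3) ((Representation.trivial ℂ (Π t : Fin 3, GL {i : Fin 3 // (id : Fin 3 → Fin 3) i = t} F) ℂ).twist (∏ i : Fin 3, ((![a * ((unramifiedTwist F 1 : QuasiChar F).toMonoidHom), a * ((unramifiedTwist F 1 : QuasiChar F).toMonoidHom) * ((unramifiedTwist F 1 : QuasiChar F).toMonoidHom), a] : Fin 3 → (Fˣ →* ℂˣ)) i).comp (Matrix.GeneralLinearGroup.det.comp (Pi.evalMonoidHom (fun t : Fin 3 => GL {i : Fin 3 // (id : Fin 3 → Fin 3) i = t} F) i))))) → Nontrivial (Representation.restrictUnipotentGL F (id : Fin 3 → Fin 3) r.ρ).Coinvariants)) {Y : Type} [AddCommGroup Y] [Module ℂ Y] (W : Representation ℂ (GL (Fin 3) F) Y) [W.IsIrreducible] (hW : W.IsSmooth)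
    [FiniteDimensional ℂ (Representation.restrictUnipotentGL F (id : Fin 3 → Fin 3) W).Coinvariants]
    (h : finrank ℂ ↥(⨅ m, Module.End.maxGenEigenspace (Representation.normalizedJacquetGL F (id : Fin 3 → Fin 3) W m) (((((∏ i : Fin 3, ((![a * ((unramifiedTwist F 1 : QuasiChar F).toMonoidHom) * ((unramifiedTwist F 1 : QuasiChar F).toMonoidHom), a * ((unramifiedTwist F 1 : QuasiChar F).toMonoidHom), a] : Fin 3 → (Fˣ →* ℂˣ)) i).comp (Matrix.GeneralLinearGroup.det.comp (Pi.evalMonoidHom (fun t : Fin 3 => GL {i : Fin 3 // (id : Fin 3 → Fin 3) i = t} F) i)))) m : ℂˣ) : ℂ))) ≠ 0)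
    [MeasurableSpace (GL (Fin 3) F)] [BorelSpace (GL (Fin 3) F)] (μ : Measure (GL (Fin 3) F)) [IsFiniteMeasureOnCompacts μ] (f : GL (Fin 3) F → ℂ) :
    W.smoothTrace μ f = (Representation.parabolicIndGL F (id : Fin 3 → Fin 3) ((Representation.trivial ℂ (Π t : Fin 3, GL {i : Fin 3 // (id : Fin 3 → Fin 3) i = t} F) ℂ).twist (∏ i : Fin 3, ((![a, a * ((unramifiedTwist F 1 : QuasiChar F).toMonoidHom), a * ((unramifiedTwist F 1 : QuasiChar F).toMonoidHom) * ((unramifiedTwist F 1 : QuasiChar F).toMonoidHom)] : Fin 3 → (Fˣ →* ℂˣ)) i).comp (Matrix.GeneralLinearGroup.det.comp (Pi.evalMonoidHom (fun t : Fin 3 => GL {i : Fin 3 // (id : Fin 3 → Fin 3) i = t} F) i))))).smoothTrace μ f - (Representation.parabolicIndGL F (![false, false, true] : Fin 3 → Bool) ((Representation.trivial ℂ (Π t : Bool, GL {i : Fin 3 // (![false, false, true] : Fin 3 → Bool) i = t} F) ℂ).twist ((a * ((unramifiedTwist F (1 / 2) : QuasiChar F).toMonoidHom)).comp ((Matrix.GeneralLinearGroup.det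 : GL {i : Fin 3 // (![false, false, true] : Fin 3 → Bool) i = false} F →* Fˣ).comp (Pi.evalMonoidHom (fun t : Bool => GL {i : Fin 3 // (![false, false, true] : Fin 3 → Bool) i = t} F) false)) * (a * ((unramifiedTwist F 1 : QuasiChar F).toMonoidHom) * ((unramifiedTwist F 1 : QuasiChar F).toMonoidHom)).comp ((Matrix.GeneralLinearGroup.det : GL {i : Fin 3 // (![false, false, true] : Fin 3 → Bool) i = true} F →* Fˣ).comp (Pi.evalMonoidHom (fun t : Bool => GL {i : Fin 3 // (![false, false, true] : Fin 3 → Bool) i = t} F) true))))).smoothTrace μ f - (Representation.parabolicIndGL F (![false, false, true] : Fin 3 → Bool) ((Representation.trivial ℂ (Π t : Bool, GL {i : Fin 3 // (![false, false, true] : Fin 3 → Bool) i = t} F) ℂ).twist ((a * ((unramifiedTwist F 1 : QuasiChar F).toMonoidHom) * ((unramifiedTwist F (1 / 2) : QuasiChar F).toMonoidHom)).comp ((Matrix.GeneralLinearGroup.det : GL {i : Fin 3 // (![false, false, true] : Fin 3 → Bool) i = false} F →* Fˣ).comp (Pi.evalMonoidHom (fun t : Bool => GL {i : Fin 3 // (![false,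 false, true] : Fin 3 → Bool) i = t} F) false)) * (a).comp ((Matrix.GeneralLinearGroup.det : GL {i : Fin 3 // (![false, false, true] : Fin 3 → Bool) i = true} F →* Fˣ).comp (Pi.evalMonoidHom (fun t : Bool => GL {i : Fin 3 // (![false, false, true] : Fin 3 → Bool) i = t} F) true))))).smoothTrace μ f + ((Representation.trivial ℂ (GL (Fin 3) F) ℂ).twist ((a * ((unramifiedTwist F 1 : QuasiChar F).toMonoidHom)).comp (Matrix.GeneralLinearGroup.det : GL (Fin 3) F →* Fˣ))).smoothTrace μ f := by
  have hIadm := isAdmissible_I_cube a ha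
  have h_ob := exists_injective_intertwiningMap_D a ha
  obtain ⟨ΦD, hΦD⟩ := h_ob
  have h_ob := nonempty_equiv_range ΦD hΦD
  obtain ⟨eD⟩ := h_ob
  have hV₂adm : ΦD.range.quotientRep.IsAdmissible := hIadm.quotientRep ΦD.range
  have h_ob := exists_subquotient_of_weight_C₂ a ha hD ΦD hΦD W hW h
  obtain ⟨P, T, ⟨e⟩⟩ := h_ob
  have key := smoothTrace_pieces a ha hD hD' hS₁₂ hJ₁ hJ₄' ΦD hΦD W hW h P T e μ f
  have e1 := Representation.smoothTrace_eq_add_of_subrepresentation _ μ hIadm ΦD.range f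
  have e2 := Representation.smoothTrace_eq_add_of_subrepresentation _ μ hV₂adm P f
  have e5 := congrFun (Representation.smoothTrace_eq_of_equiv _ μ eD) f
  linear_combination -e1 - e5 - e2 - key

end Summit.HodgeConjecture.HodgeConjecture.Cruxes.H413.K2E3GL3CubeClassTwo

end
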